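import Literature.Probability.RandomMatrixProducts.AndersonModel1DCircle
import Literature.Probability.RandomMatrixProducts.AndersonModel1DLDT
import Literature.Probability.RandomMatrixProducts.AndersonModel1DPositivity
import Literature.Probability.RandomMatrixProducts.AndersonModel1DContinuityBasics
import Mathlib.MeasureTheory.Measure.Prokhorov
import Mathlib.MeasureTheory.Measure.LevyProkhorovMetric
import Mathlib.MeasureTheory.Measure.HasOuterApproxClosed
import Mathlib.MeasureTheory.Integral.DominatedConvergence
import Mathlib.MeasureTheory.Integral.Prod
import Mathlib.Topology.UniformSpace.HeineCantor
import HarnessLib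

/-!
# Large deviations for the Anderson model, II: stationary measures on the circle, Fürstenberg's formula, uniform one-scale bounds, and the proof of Bucaj et al. Prop. 3.6 (`BucajEtAl2019_vectorLDT_holds`)

Companion to `AndersonModel1D.lean` (Bucaj–Damanik–Fillman–Gerbuz–VandenBoom–Wang–Zhang, *Localization
for the one-dimensional Anderson model via positivity and large deviations for the Lyapunov exponent*,
TAMS **372** (2019) 3619–3667, arXiv:1706.06135, §§2–3), `AndersonModel1DCircle.lean` (the projective
dynamics: `projAct`, `circlePsi = ψ_E`, `circleMarkov = Q_E`, `dirVec`, `dirLaw`, `cesaroLaw`,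
`IsStationaryFor`) and `AndersonModel1DLDT.lean` (the bootstrapping `vectorLDT_of_uniformScale`).
Everything here is PROVED, and the file ends with the discharge
`BucajEtAl2019_vectorLDT_holds : BucajEtAl2019_vectorLDT` of the vectorwise uniform large-deviation
theorem, Prop. 3.6 of the source.

## The argument

The source proves Prop. 3.6 from Prop. 2.10 (Bougerol–Lacroix: a.s. convergence
`n⁻¹ log ‖M_n v_n‖ → L` along convergent unit vectors, resting on strong irreducibility and
contractivity of `G_{ν_E}`, Thm 2.3 / Prop. 2.9), Props. 3.2/3.4 (one-scale bounds in probability,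
locally uniform in `E` by the continuity of `L`, Thm 2.6 = Fürstenberg–Kifer), and a block-independence
count.  We keep the architecture but prove the two deep inputs directly for the Anderson matrices:

* **Part A/B** — the one-step cocycle `log ‖M^E(a) v‖` on the circle (bounds, continuity, Lipschitz
  dependence on `E`: Lemma 3.3), the recursion `∫ f d(dirLaw_{n+1}) = ∫ Q_E f d(dirLaw_n)`, the
  telescoping `𝔼 log ‖M_n w‖ = Σ_{k<n} 𝔼 ψ_E(v_k) = (n) ∫ ψ_E d(cesaroLaw_{n-1})`, and the
  Krylov–Bogolyubov almost-invariance of the Cesàro averages.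
* **Part C/D** — stationary measures: `n`-step invariance, the upper Fürstenberg bound
  `∫ ψ_E dν ≤ L(E)`, and **non-atomicity** of every stationary probability measure when `supp μ` has
  two points (the maximal atoms form a finite set invariant under `(M^E(a))⁻¹`, `a ∈ supp μ`, hence
  under the shear `M^E(a) M^E(b)⁻¹ = [[1, b-a],[0,1]]`, which has no finite invariant set off `±e₁`,
  while `(M^E(a))⁻¹ e₁ = -e₂`) — this is the strong irreducibility of Thm 2.3 made effective.
* **Part E** — thin bands `{v : |u·v| < r}` of a non-atomic measure are uniformly small (compactness of
  the circle); the larger-row bound `‖B v‖ ≥ ‖B‖ |s·v|/√2` then gives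
  `∫∫ log ‖M_m v‖ dρ dμ^{⊗m} ≥ m L + log r - log √2 - 2δ m log Γ`, whence the lower Fürstenberg bound
  and **Fürstenberg's formula** `∫ ψ_E dν = L(E)` for EVERY stationary `ν` (the content of
  Fürstenberg–Kifer, Thm 2.5, in this model).
* **Part F** — compactness of the probability measures on the circle (Mathlib's Riesz–Markov /
  Prokhorov instance) and of `Σ̂`: weak limits of (almost) stationary measures along `E_j → E` are
  stationary; by contradiction this yields the uniform lower bound `𝔼 log ‖M_n^E w‖ ≥ n(L(E) - ε)`
  (Props. 3.2/3.4) and the uniform upper bound `n⁻¹ 𝔼 log ‖M_n^E‖ ≤ L(E) + ε` on `Σ̂` (Thm 2.6 with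
  Fekete); together `|𝔼 log ‖M_N^E u‖ - N L(E)| ≤ N ε` uniformly, which `vectorLDT_of_uniformScale`
  turns into Prop. 3.6.

References: H. Furstenberg, Trans. AMS **108** (1963) 377–428; H. Furstenberg, Y. Kifer, Israel J. Math.
**46** (1983) 12–32; P. Bougerol, J. Lacroix, *Products of Random Matrices with Applications to
Schrödinger Operators* (1985), Part A Ch. II–III; Bucaj et al. (2019) §§2–3.
-/



/-! ## Part A/B: the one-step cocycle on the circle, laws of directions, telescoping, approximate invariance of Cesàro averages -/

noncomputable section

open MeasureTheory Set Filter Topology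
open scoped Matrix.Norms.L2Operator ENNReal Matrix

namespace Literature.Probability.RandomMatrixProducts

local notation "𝕊" => Metric.sphere (0 : EuclideanSpace ℝ (Fin 2)) 1

local notation "Γ[" μ "]" => (2 * andersonKappa μ - 1 : ℝ)

/-! ### The one-step cocycle `log ‖M^E(a) v‖` on the circle -/

/-- `‖M^E(a) v‖ ≤ |E - a| + 1` on the circle. [folklore] -/
theorem norm_transfer_apply_le_circle (E a : ℝ) (v : 𝕊) :
    ‖Matrix.toEuclideanLin (andersonTransfer E a) v‖ ≤ |E - a| + 1 := by
  simpa [norm_coe_circle v] using norm_andersonTransfer_apply_le E a (v : EuclideanSpace ℝ (Fin 2))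

/-- `(|E - a| + 1)⁻¹ ≤ ‖M^E(a) v‖` on the circle. [folklore] -/
theorem inv_le_norm_transfer_apply_circle (E a : ℝ) (v : 𝕊) :
    (|E - a| + 1)⁻¹ ≤ ‖Matrix.toEuclideanLin (andersonTransfer E a) v‖ := by
  have h := norm_le_norm_andersonTransfer_apply E a (v : EuclideanSpace ℝ (Fin 2))
  rw [norm_coe_circle v] at h
  have hpos : 0 < |E - a| + 1 := by positivity
  rw [inv_le_iff_one_le_mul₀ hpos, mul_comm]
  exact h

/-- `‖M^E(a) v‖ > 0` on the circle. [folklore] -/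
theorem norm_transfer_apply_pos_circle (E a : ℝ) (v : 𝕊) :
    0 < ‖Matrix.toEuclideanLin (andersonTransfer E a) v‖ :=
  lt_of_lt_of_le (by positivity) (inv_le_norm_transfer_apply_circle E a v)

/-- `|log ‖M^E(a) v‖| ≤ log (|E - a| + 1)` on the circle. [folklore] -/
theorem abs_log_norm_transfer_apply_le_circle (E a : ℝ) (v : 𝕊) :
    |Real.log ‖Matrix.toEuclideanLin (andersonTransfer E a) v‖| ≤ Real.log (|E - a| + 1) := by
  have hpos : 0 < |E - a| + 1 := by positivity
  have h1 := norm_transfer_apply_le_circle E a v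
  have h2 := inv_le_norm_transfer_apply_circle E a v
  have h0 := norm_transfer_apply_pos_circle E a v
  rw [abs_le]
  constructor
  · rw [← Real.log_inv]
    exact Real.log_le_log (inv_pos.mpr hpos) h2
  · exact Real.log_le_log h0 h1

/-- In the energy window and the support box, `|log ‖M^E(a) v‖| ≤ log Γ`. [cite: BucajEtAl2019, §3 (display (3.3))] -/
theorem abs_log_norm_transfer_apply_le_log_gam {μ : Measure ℝ} {E a : ℝ}
    (hE : E ∈ Icc (-andersonKappa μ) (andersonKappa μ)) (ha : |a| ≤ andersonKappa μ - 2) (v : 𝕊) :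
    |Real.log ‖Matrix.toEuclideanLin (andersonTransfer E a) v‖| ≤ Real.log Γ[μ] := by
  refine (abs_log_norm_transfer_apply_le_circle E a v).trans (Real.log_le_log (by positivity) ?_)
  have := abs_sub_le_gam_sub_one hE ha
  linarith

/-- `a ↦ log ‖M^E(a) v‖` is continuous. [folklore] -/
theorem continuous_log_norm_transfer_apply_left (E : ℝ) (v : 𝕊) :
    Continuous fun a : ℝ => Real.log ‖Matrix.toEuclideanLin (andersonTransfer E a) v‖ := by
  refine Continuous.log ?_ fun a => (norm_transfer_apply_pos_circle E a v).ne'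
  refine (continuous_toEuclideanLin_apply (fun i j => ?_) continuous_const).norm
  fin_cases i <;> fin_cases j <;> simp [andersonTransfer] <;> fun_prop

/-- `v ↦ log ‖M^E(a) v‖` is continuous on the circle. [folklore] -/
theorem continuous_log_norm_transfer_apply_right (E a : ℝ) :
    Continuous fun v : 𝕊 => Real.log ‖Matrix.toEuclideanLin (andersonTransfer E a) v‖ := by
  refine Continuous.log ?_ fun v => (norm_transfer_apply_pos_circle E a v).ne'
  have h : Continuous fun v : 𝕊 => Matrix.toEuclideanLin (andersonTransfer E a) v :=
    continuous_toEuclideanLin_apply (M := fun _ : 𝕊 => andersonTransfer E a)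
      (u := fun v : 𝕊 => (v : EuclideanSpace ℝ (Fin 2))) (fun _ _ => continuous_const) continuous_subtype_val
  exact h.norm

/-- `(a, v) ↦ log ‖M^E(a) v‖` is continuous. [folklore] -/
theorem continuous_log_norm_transfer_apply (E : ℝ) :
    Continuous fun p : ℝ × 𝕊 => Real.log ‖Matrix.toEuclideanLin (andersonTransfer E p.1) p.2‖ := by
  refine Continuous.log ?_ fun p => (norm_transfer_apply_pos_circle E p.1 p.2).ne'
  refine (continuous_toEuclideanLin_apply (fun i j => ?_) (continuous_subtype_val.comp continuous_snd)).norm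
  fin_cases i <;> fin_cases j <;> simp [andersonTransfer] <;> fun_prop

/-- The one-step cocycle is integrable in the potential (compactly supported law). [folklore] -/
theorem integrable_log_norm_transfer_apply {μ : Measure ℝ} [IsProbabilityMeasure μ] (hc : IsCompact μ.support)
    (E : ℝ) (v : 𝕊) :
    Integrable (fun a : ℝ => Real.log ‖Matrix.toEuclideanLin (andersonTransfer E a) v‖) μ := by
  refine Integrable.of_bound (continuous_log_norm_transfer_apply_left E v).measurable.aestronglyMeasurable
    (Real.log (|E| + (andersonKappa μ - 2) + 1)) ?_
  filter_upwards [ae_abs_le_andersonKappa_sub_two μ hc] with a ha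
  rw [Real.norm_eq_abs]
  refine (abs_log_norm_transfer_apply_le_circle E a v).trans (Real.log_le_log (by positivity) ?_)
  linarith [abs_sub E a]

/-- **`|ψ_E(v)| ≤ log Γ`** for `E ∈ Σ̂`. [cite: BucajEtAl2019, §3 (display (3.3))] -/
theorem abs_circlePsi_le {μ : Measure ℝ} [IsProbabilityMeasure μ] (hc : IsCompact μ.support) {E : ℝ}
    (hE : E ∈ Icc (-andersonKappa μ) (andersonKappa μ)) (v : 𝕊) :
    |circlePsi μ E v| ≤ Real.log Γ[μ] := by
  unfold circlePsi
  have h1 : |∫ a, Real.log ‖Matrix.toEuclideanLin (andersonTransfer E a) v‖ ∂μ| ≤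
      ∫ a, |Real.log ‖Matrix.toEuclideanLin (andersonTransfer E a) v‖| ∂μ := abs_integral_le_integral_abs
  refine h1.trans ?_
  have h2 : ∫ a, |Real.log ‖Matrix.toEuclideanLin (andersonTransfer E a) v‖| ∂μ ≤ ∫ _a, Real.log Γ[μ] ∂μ := by
    refine integral_mono_ae (integrable_log_norm_transfer_apply hc E v).abs (integrable_const _) ?_
    filter_upwards [ae_abs_le_andersonKappa_sub_two μ hc] with a ha
    exact abs_log_norm_transfer_apply_le_log_gam hE ha v
  refine h2.trans ?_
  rw [integral_const, probReal_univ, one_smul]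

/-- **`ψ_E` is continuous on the circle** (dominated convergence). [folklore] -/
theorem continuous_circlePsi {μ : Measure ℝ} [IsProbabilityMeasure μ] (hc : IsCompact μ.support) (E : ℝ) :
    Continuous (circlePsi μ E) := by
  unfold circlePsi
  refine continuous_of_dominated (bound := fun _ => Real.log (|E| + (andersonKappa μ - 2) + 1)) ?_ ?_
    (integrable_const _) ?_
  · exact fun v => (continuous_log_norm_transfer_apply_left E v).measurable.aestronglyMeasurable
  · intro v
    filter_upwards [ae_abs_le_andersonKappa_sub_two μ hc] with a ha
    rw [Real.norm_eq_abs]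
    refine (abs_log_norm_transfer_apply_le_circle E a v).trans (Real.log_le_log (by positivity) ?_)
    linarith [abs_sub E a]
  · exact Eventually.of_forall fun a => continuous_log_norm_transfer_apply_right E a

/-- `ψ_E` is measurable. [folklore] -/
theorem measurable_circlePsi {μ : Measure ℝ} [IsProbabilityMeasure μ] (hc : IsCompact μ.support) (E : ℝ) :
    Measurable (circlePsi μ E) :=
  (continuous_circlePsi hc E).measurable

/-- `M^E(a) - M^{E'}(a)` acts with norm at most `|E - E'|`. [cite: BucajEtAl2019, Lemma 3.3 (energy part, one step)] -/
theorem norm_transfer_sub_transfer_apply_le (E E' a : ℝ) (v : 𝕊) :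
    ‖Matrix.toEuclideanLin (andersonTransfer E a) v - Matrix.toEuclideanLin (andersonTransfer E' a) v‖ ≤ |E - E'| := by
  rw [← LinearMap.sub_apply, ← map_sub]
  have h : andersonTransfer E a - andersonTransfer E' a = !![E - E', 0; 0, 0] := by
    ext i j
    fin_cases i <;> fin_cases j <;> simp [andersonTransfer]
  rw [h]
  simpa [norm_coe_circle v] using norm_single_entry_apply_le (E - E') (v : EuclideanSpace ℝ (Fin 2))

/-- **Lipschitz dependence of the one-step cocycle on the energy**:
`|log ‖M^E(a) v‖ - log ‖M^{E'}(a) v‖| ≤ (max |E - a| |E' - a| + 1) |E - E'|`. [cite: BucajEtAl2019, Lemma 3.3] -/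
theorem abs_log_norm_transfer_apply_sub_le (E E' a : ℝ) (v : 𝕊) :
    |Real.log ‖Matrix.toEuclideanLin (andersonTransfer E a) v‖ -
        Real.log ‖Matrix.toEuclideanLin (andersonTransfer E' a) v‖| ≤
      (max |E - a| |E' - a| + 1) * |E - E'| := by
  set c : ℝ := (max |E - a| |E' - a| + 1)⁻¹ with hc
  have hD : 0 < max |E - a| |E' - a| + 1 := by positivity
  have hc0 : 0 < c := inv_pos.mpr hD
  have hx : c ≤ ‖Matrix.toEuclideanLin (andersonTransfer E a) v‖ := by
    refine le_trans ?_ (inv_le_norm_transfer_apply_circle E a v)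
    rw [hc]
    exact inv_anti₀ (by positivity) (by gcongr; exact le_max_left _ _)
  have hy : c ≤ ‖Matrix.toEuclideanLin (andersonTransfer E' a) v‖ := by
    refine le_trans ?_ (inv_le_norm_transfer_apply_circle E' a v)
    rw [hc]
    exact inv_anti₀ (by positivity) (by gcongr; exact le_max_right _ _)
  refine (abs_log_sub_log_le hc0 hx hy).trans ?_
  rw [hc, div_inv_eq_mul, mul_comm]
  exact mul_le_mul_of_nonneg_left ((abs_norm_sub_norm_le _ _).trans (norm_transfer_sub_transfer_apply_le E E' a v)) hD.le

/-- **`ψ_E` is Lipschitz in `E` on `Σ̂`, uniformly on the circle**: `|ψ_E(v) - ψ_{E'}(v)| ≤ Γ |E - E'|`.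
[cite: BucajEtAl2019, Lemma 3.3 (display (3.7))] -/
theorem abs_circlePsi_sub_circlePsi_le {μ : Measure ℝ} [IsProbabilityMeasure μ] (hc : IsCompact μ.support)
    {E E' : ℝ} (hE : E ∈ Icc (-andersonKappa μ) (andersonKappa μ)) (hE' : E' ∈ Icc (-andersonKappa μ) (andersonKappa μ))
    (v : 𝕊) : |circlePsi μ E v - circlePsi μ E' v| ≤ Γ[μ] * |E - E'| := by
  unfold circlePsi
  rw [← integral_sub (integrable_log_norm_transfer_apply hc E v) (integrable_log_norm_transfer_apply hc E' v)]
  refine abs_integral_le_integral_abs.trans ?_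
  have h : ∫ a, |Real.log ‖Matrix.toEuclideanLin (andersonTransfer E a) v‖ -
      Real.log ‖Matrix.toEuclideanLin (andersonTransfer E' a) v‖| ∂μ ≤ ∫ _a, Γ[μ] * |E - E'| ∂μ := by
    refine integral_mono_ae ((integrable_log_norm_transfer_apply hc E v).sub
      (integrable_log_norm_transfer_apply hc E' v)).abs (integrable_const _) ?_
    filter_upwards [ae_abs_le_andersonKappa_sub_two μ hc] with a ha
    refine (abs_log_norm_transfer_apply_sub_le E E' a v).trans ?_
    gcongr
    have h1 := abs_sub_le_gam_sub_one hE ha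
    have h2 := abs_sub_le_gam_sub_one hE' ha
    have : max |E - a| |E' - a| ≤ Γ[μ] - 1 := max_le h1 h2
    linarith
  refine h.trans ?_
  rw [integral_const, probReal_univ, one_smul]

/-! ### Continuity in the starting direction of averages along the chain -/

/-- For a fixed sample, `v ↦ M_n(x) · v` is continuous on the circle. [folklore] -/
theorem continuous_dirVec_left (E : ℝ) (n : ℕ) (x : Fin n → ℝ) : Continuous fun v : 𝕊 => dirVec E n v x :=
  continuous_projAct_of (M := fun _ => andersonTransferProd E (padSeq x) n)
    (continuous_toEuclideanLin_apply (fun _ _ => continuous_const) continuous_subtype_val)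
    fun v => toEuclideanLin_apply_ne_zero (det_andersonTransferProd_ne_zero E _ n) (coe_circle_ne_zero v)

/-- `(v, x) ↦ M_n(x) · v` is continuous. [folklore] -/
theorem continuous_dirVec_uncurry (E : ℝ) (n : ℕ) : Continuous fun p : 𝕊 × (Fin n → ℝ) => dirVec E n p.1 p.2 := by
  refine continuous_projAct_of (M := fun p : 𝕊 × (Fin n → ℝ) => andersonTransferProd E (padSeq p.2) n) ?_
    fun p => toEuclideanLin_apply_ne_zero (det_andersonTransferProd_ne_zero E _ n) (coe_circle_ne_zero p.1)
  refine continuous_toEuclideanLin_apply (fun i j => ?_) (continuous_subtype_val.comp continuous_fst)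
  exact ((continuous_apply j).comp ((continuous_apply i).comp (continuous_andersonTransferProd E n))).comp continuous_snd

/-- **Continuity of the `n`-step averages in the starting direction**: for `f` continuous and bounded,
`v ↦ ∫ f(M_n(x) · v) dμ^{⊗n}(x)` is continuous (dominated convergence). [folklore] -/
theorem continuous_integral_dirVec (μ : Measure ℝ) [IsProbabilityMeasure μ] (E : ℝ) (n : ℕ) {f : 𝕊 → ℝ}
    (hf : Continuous f) {C : ℝ} (hC : ∀ v, |f v| ≤ C) :
    Continuous fun v : 𝕊 => ∫ x, f (dirVec E n v x) ∂(Measure.pi fun _ : Fin n => μ) := by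
  refine continuous_of_dominated (bound := fun _ => C) ?_ ?_ (integrable_const _) ?_
  · exact fun v => (hf.comp (continuous_dirVec E n v)).measurable.aestronglyMeasurable
  · exact fun v => Eventually.of_forall fun x => by rw [Real.norm_eq_abs]; exact hC _
  · exact Eventually.of_forall fun x => hf.comp (continuous_dirVec_left E n x)

/-- The `n`-step averages are bounded by the bound of `f`. [folklore] -/
theorem abs_integral_dirVec_le (μ : Measure ℝ) [IsProbabilityMeasure μ] (E : ℝ) (n : ℕ) {f : 𝕊 → ℝ}
    {C : ℝ} (hC : ∀ v, |f v| ≤ C) (v : 𝕊) :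
    |∫ x, f (dirVec E n v x) ∂(Measure.pi fun _ : Fin n => μ)| ≤ C := by
  refine abs_integral_le_integral_abs.trans ?_
  have h : ∫ x, |f (dirVec E n v x)| ∂(Measure.pi fun _ : Fin n => μ) ≤ ∫ _x, C ∂(Measure.pi fun _ : Fin n => μ) := by
    refine integral_mono_of_nonneg (Eventually.of_forall fun x => abs_nonneg _) (integrable_const _)
      (Eventually.of_forall fun x => hC _)
  refine h.trans ?_
  rw [integral_const, probReal_univ, one_smul]

/-- **The Markov operator preserves continuity**: `Q_E f` is continuous for `f` continuous and bounded
(dominated convergence). [folklore] -/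
theorem continuous_circleMarkov (μ : Measure ℝ) [IsProbabilityMeasure μ] (E : ℝ) {f : 𝕊 → ℝ} (hf : Continuous f)
    {C : ℝ} (hC : ∀ v, |f v| ≤ C) : Continuous (circleMarkov μ E f) := by
  unfold circleMarkov
  refine continuous_of_dominated (bound := fun _ => C) ?_ ?_ (integrable_const _) ?_
  · exact fun v => (hf.comp (continuous_projAct_andersonTransfer_left E v)).measurable.aestronglyMeasurable
  · exact fun v => Eventually.of_forall fun x => by rw [Real.norm_eq_abs]; exact hC _
  · exact Eventually.of_forall fun a => hf.comp (continuous_projAct_andersonTransfer_right E a)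

/-- `|Q_E f| ≤ C` if `|f| ≤ C`. [folklore] -/
theorem abs_circleMarkov_le (μ : Measure ℝ) [IsProbabilityMeasure μ] (E : ℝ) {f : 𝕊 → ℝ} {C : ℝ}
    (hC : ∀ v, |f v| ≤ C) (v : 𝕊) : |circleMarkov μ E f v| ≤ C := by
  unfold circleMarkov
  refine abs_integral_le_integral_abs.trans ?_
  have h : ∫ a, |f (projAct (andersonTransfer E a) v)| ∂μ ≤ ∫ _a, C ∂μ :=
    integral_mono_of_nonneg (Eventually.of_forall fun x => abs_nonneg _) (integrable_const _)
      (Eventually.of_forall fun x => hC _)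
  refine h.trans ?_
  rw [integral_const, probReal_univ, one_smul]

/-- `Q_E f` is (strongly) measurable for `f` measurable and bounded. [folklore] -/
theorem measurable_circleMarkov (μ : Measure ℝ) [IsProbabilityMeasure μ] (E : ℝ) {f : 𝕊 → ℝ} (hf : Measurable f) :
    Measurable (circleMarkov μ E f) := by
  have h : StronglyMeasurable fun p : ℝ × 𝕊 => f (projAct (andersonTransfer E p.1) p.2) :=
    (hf.comp (measurable_projAct_andersonTransfer E)).stronglyMeasurable
  exact (h.integral_prod_left (μ := μ)).measurable

/-! ### One more step: the laws of directions and the log-norms -/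

/-- **Recursion of the laws of directions**: `∫ f d(dirLaw_{n+1} w) = ∫ Q_E f d(dirLaw_n w)` for bounded
measurable `f` (the chain of directions is a Markov chain with transition operator `Q_E`).
[cite: BucajEtAl2019, §3 (proof of Prop. 3.6: `v_{p}` depends on the past, `M_N(T^{pN}ω)` is independent of it)] -/
theorem integral_dirLaw_succ (μ : Measure ℝ) [IsProbabilityMeasure μ] (E : ℝ) (n : ℕ) (w : 𝕊) {f : 𝕊 → ℝ}
    (hf : Measurable f) {C : ℝ} (hC : ∀ v, |f v| ≤ C) :
    ∫ v, f v ∂(dirLaw μ E (n + 1) w) = ∫ v, circleMarkov μ E f v ∂(dirLaw μ E n w) := by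
  rw [integral_dirLaw _ _ _ _ hf.aestronglyMeasurable,
    integral_dirLaw _ _ _ _ (measurable_circleMarkov μ E hf).aestronglyMeasurable]
  have hmeas : Measurable fun z : Fin (n + 1) → ℝ => f (dirVec E (n + 1) w z) := hf.comp (measurable_dirVec E (n + 1) w)
  have hint : Integrable (fun z : Fin (n + 1) → ℝ => f (dirVec E (n + 1) w z)) (Measure.pi fun _ : Fin (n + 1) => μ) :=
    Integrable.of_bound hmeas.aestronglyMeasurable C (Eventually.of_forall fun z => by rw [Real.norm_eq_abs]; exact hC _)
  rw [integral_pi_succ_eq_integral_integral μ n hmeas hint]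
  refine integral_congr_ae (Eventually.of_forall fun x => ?_)
  simp only [dirVec_append_one]
  rfl

/-- `M_n(x) w = ‖M_n(x) w‖ • v_n(x)`. [folklore] -/
theorem transferProd_apply_eq_norm_smul_dirVec (E : ℝ) (n : ℕ) (w : 𝕊) (x : Fin n → ℝ) :
    Matrix.toEuclideanLin (andersonTransferProd E (padSeq x) n) w =
      ‖Matrix.toEuclideanLin (andersonTransferProd E (padSeq x) n) w‖ • (dirVec E n w x : EuclideanSpace ℝ (Fin 2)) :=
  toEuclideanLin_apply_eq_norm_smul_projAct
    (toEuclideanLin_apply_ne_zero (det_andersonTransferProd_ne_zero E _ n) (coe_circle_ne_zero w))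

/-- **The cocycle property of the log-norms**: `log ‖M_{n+1}(x ⧺ (a)) w‖ = log ‖M_n(x) w‖ + log ‖M^E(a) v_n(x)‖`.
[cite: BucajEtAl2019, §3 (proof of Prop. 3.6, the displayed telescoping of `log ‖M_n v‖`)] -/
theorem log_norm_transferProd_succ_apply (E : ℝ) (n : ℕ) (w : 𝕊) (x : Fin n → ℝ) (a : ℝ) :
    Real.log ‖Matrix.toEuclideanLin (andersonTransferProd E (padSeq (Fin.append x (fun _ : Fin 1 => a))) (n + 1)) w‖ =
      Real.log ‖Matrix.toEuclideanLin (andersonTransferProd E (padSeq x) n) w‖ +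
        Real.log ‖Matrix.toEuclideanLin (andersonTransfer E a) (dirVec E n w x)‖ := by
  have h1 : andersonTransferProd E (padSeq fun _ : Fin 1 => a) 1 = andersonTransfer E a := by
    show andersonTransfer E (padSeq (fun _ : Fin 1 => a) 0) * 1 = andersonTransfer E a
    rw [padSeq_of_lt _ Nat.zero_lt_one, mul_one]
  have hb : 0 < ‖Matrix.toEuclideanLin (andersonTransferProd E (padSeq x) n) w‖ :=
    norm_pos_iff.mpr (toEuclideanLin_apply_ne_zero (det_andersonTransferProd_ne_zero E _ n) (coe_circle_ne_zero w))
  have key : Matrix.toEuclideanLin (andersonTransfer E a) (Matrix.toEuclideanLin (andersonTransferProd E (padSeq x) n) w) =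
      ‖Matrix.toEuclideanLin (andersonTransferProd E (padSeq x) n) w‖ •
        Matrix.toEuclideanLin (andersonTransfer E a) (dirVec E n w x) := by
    conv_lhs => rw [transferProd_apply_eq_norm_smul_dirVec E n w x]
    rw [map_smul]
  rw [andersonTransferProd_append, toEuclideanLin_mul_apply, h1, key, norm_smul, Real.norm_eq_abs, abs_of_pos hb,
    Real.log_mul hb.ne' (norm_transfer_apply_pos_circle E a _).ne']

/-- **Telescoping, one step**: `𝔼 log ‖M_{n+1} w‖ = 𝔼 log ‖M_n w‖ + 𝔼 ψ_E(v_n)`.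
[cite: BucajEtAl2019, §3 (proof of Prop. 3.6)] -/
theorem integral_log_norm_apply_succ {μ : Measure ℝ} [IsProbabilityMeasure μ] (hc : IsCompact μ.support)
    {E : ℝ} (hE : E ∈ Icc (-andersonKappa μ) (andersonKappa μ)) (n : ℕ) (w : 𝕊) :
    ∫ z, Real.log ‖Matrix.toEuclideanLin (andersonTransferProd E (padSeq z) (n + 1)) w‖ ∂(Measure.pi fun _ : Fin (n + 1) => μ) =
      ∫ x, Real.log ‖Matrix.toEuclideanLin (andersonTransferProd E (padSeq x) n) w‖ ∂(Measure.pi fun _ : Fin n => μ) +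
        ∫ x, circlePsi μ E (dirVec E n w x) ∂(Measure.pi fun _ : Fin n => μ) := by
  have hw : ‖(w : EuclideanSpace ℝ (Fin 2))‖ = 1 := norm_coe_circle w
  rw [integral_pi_succ_eq_integral_integral μ n (measurable_log_norm_andersonTransferProd_apply E (n + 1) _)
    (integrable_log_norm_apply hc hE (n + 1) le_rfl hw)]
  have key : ∀ x : Fin n → ℝ,
      ∫ a, Real.log ‖Matrix.toEuclideanLin (andersonTransferProd E (padSeq (Fin.append x (fun _ : Fin 1 => a))) (n + 1)) w‖ ∂μ =
        Real.log ‖Matrix.toEuclideanLin (andersonTransferProd E (padSeq x) n) w‖ + circlePsi μ E (dirVec E n w x) := by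
    intro x
    simp_rw [log_norm_transferProd_succ_apply]
    rw [integral_add (integrable_const _) (integrable_log_norm_transfer_apply hc E _), integral_const, probReal_univ,
      one_smul]
    rfl
  simp_rw [key]
  rw [integral_add (integrable_log_norm_apply hc hE n le_rfl hw)]
  refine Integrable.of_bound ((measurable_circlePsi hc E).comp (measurable_dirVec E n w)).aestronglyMeasurable
    (Real.log Γ[μ]) (Eventually.of_forall fun x => ?_)
  rw [Real.norm_eq_abs]
  exact abs_circlePsi_le hc hE _

/-- **Telescoping**: `𝔼 log ‖M_n w‖ = Σ_{k<n} 𝔼 ψ_E(v_k)`, the expectation of the additive functional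
`Σ_{k<n} ψ_E(v_k)` of the chain of directions. [cite: BucajEtAl2019, §3 (proof of Prop. 3.6)] -/
theorem integral_log_norm_apply_eq_sum {μ : Measure ℝ} [IsProbabilityMeasure μ] (hc : IsCompact μ.support)
    {E : ℝ} (hE : E ∈ Icc (-andersonKappa μ) (andersonKappa μ)) (w : 𝕊) :
    ∀ n : ℕ, ∫ x, Real.log ‖Matrix.toEuclideanLin (andersonTransferProd E (padSeq x) n) w‖ ∂(Measure.pi fun _ : Fin n => μ) =
      ∑ k ∈ Finset.range n, ∫ x, circlePsi μ E (dirVec E k w x) ∂(Measure.pi fun _ : Fin k => μ)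
  | 0 => by
    simp only [Finset.range_zero, Finset.sum_empty, andersonTransferProd_zero]
    have h1 : Matrix.toEuclideanLin (1 : Matrix (Fin 2) (Fin 2) ℝ) (w : EuclideanSpace ℝ (Fin 2)) = w := by
      change WithLp.toLp 2 ((1 : Matrix (Fin 2) (Fin 2) ℝ) *ᵥ WithLp.ofLp (w : EuclideanSpace ℝ (Fin 2))) = _
      rw [Matrix.one_mulVec]
    simp only [h1, norm_coe_circle w, Real.log_one]
    exact integral_zero _ _
  | n + 1 => by
    rw [integral_log_norm_apply_succ hc hE n w, integral_log_norm_apply_eq_sum hc hE w n, Finset.sum_range_succ]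

/-- `ψ_E` is integrable against every law of directions. [folklore] -/
theorem integrable_circlePsi_dirLaw {μ : Measure ℝ} [IsProbabilityMeasure μ] (hc : IsCompact μ.support)
    {E : ℝ} (hE : E ∈ Icc (-andersonKappa μ) (andersonKappa μ)) (k : ℕ) (w : 𝕊) :
    Integrable (circlePsi μ E) (dirLaw μ E k w) :=
  Integrable.of_bound (measurable_circlePsi hc E).aestronglyMeasurable (Real.log Γ[μ])
    (Eventually.of_forall fun v => by rw [Real.norm_eq_abs]; exact abs_circlePsi_le hc hE v)

/-- **The log-moment as a Cesàro average**: `∫ ψ_E d(cesaroLaw_n w) = (n+1)⁻¹ 𝔼 log ‖M_{n+1} w‖`.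
[cite: BucajEtAl2019, §3 (proof of Prop. 3.6)] -/
theorem integral_circlePsi_cesaroLaw {μ : Measure ℝ} [IsProbabilityMeasure μ] (hc : IsCompact μ.support)
    {E : ℝ} (hE : E ∈ Icc (-andersonKappa μ) (andersonKappa μ)) (n : ℕ) (w : 𝕊) :
    ∫ v, circlePsi μ E v ∂(cesaroLaw μ E n w) =
      ((n : ℝ) + 1)⁻¹ * ∫ x, Real.log ‖Matrix.toEuclideanLin (andersonTransferProd E (padSeq x) (n + 1)) w‖
        ∂(Measure.pi fun _ : Fin (n + 1) => μ) := by
  rw [integral_cesaroLaw μ E n w (integrable_circlePsi_dirLaw hc hE · w), integral_log_norm_apply_eq_sum hc hE w (n + 1)]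
  congr 1
  refine Finset.sum_congr rfl fun k _ => ?_
  exact integral_dirLaw μ E k w (measurable_circlePsi hc E).aestronglyMeasurable

/-! ### Approximate invariance of the Cesàro averages -/

/-- **Krylov–Bogolyubov**: the Cesàro averages are almost `Q_E`-invariant,
`|∫ Q_E f d(cesaroLaw_n w) - ∫ f d(cesaroLaw_n w)| ≤ 2C/(n+1)` for `|f| ≤ C` measurable. [folklore] -/
theorem abs_integral_circleMarkov_cesaroLaw_sub_le (μ : Measure ℝ) [IsProbabilityMeasure μ] (E : ℝ) (n : ℕ) (w : 𝕊)
    {f : 𝕊 → ℝ} (hf : Measurable f) {C : ℝ} (hC : ∀ v, |f v| ≤ C) :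
    |∫ v, circleMarkov μ E f v ∂(cesaroLaw μ E n w) - ∫ v, f v ∂(cesaroLaw μ E n w)| ≤ 2 * C / (n + 1) := by
  have hC0 : 0 ≤ C := (abs_nonneg _).trans (hC w)
  set g : ℕ → ℝ := fun k => ∫ v, f v ∂(dirLaw μ E k w) with hg
  have hgb : ∀ k, |g k| ≤ C := by
    intro k
    rw [hg]
    simp only
    rw [integral_dirLaw μ E k w hf.aestronglyMeasurable]
    exact abs_integral_dirVec_le μ E k hC w
  have hfi : ∀ k, Integrable f (dirLaw μ E k w) := fun k =>
    Integrable.of_bound hf.aestronglyMeasurable C (Eventually.of_forall fun v => by rw [Real.norm_eq_abs]; exact hC _)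
  have hQi : ∀ k, Integrable (circleMarkov μ E f) (dirLaw μ E k w) := fun k =>
    Integrable.of_bound (measurable_circleMarkov μ E hf).aestronglyMeasurable C
      (Eventually.of_forall fun v => by rw [Real.norm_eq_abs]; exact abs_circleMarkov_le μ E hC _)
  rw [integral_cesaroLaw μ E n w hQi, integral_cesaroLaw μ E n w hfi]
  have h1 : ∑ k ∈ Finset.range (n + 1), ∫ v, circleMarkov μ E f v ∂(dirLaw μ E k w) =
      ∑ k ∈ Finset.range (n + 1), g (k + 1) := by
    refine Finset.sum_congr rfl fun k _ => ?_
    rw [hg]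
    exact (integral_dirLaw_succ μ E k w hf hC).symm
  have h2 : ∑ k ∈ Finset.range (n + 1), g (k + 1) = ∑ k ∈ Finset.range (n + 1), g k + (g (n + 1) - g 0) := by
    have h3 := Finset.sum_range_succ' g (n + 1)
    have h4 := Finset.sum_range_succ g (n + 1)
    linarith
  have hn : (0 : ℝ) < n + 1 := by positivity
  rw [h1, h2, ← mul_sub, add_sub_cancel_left, abs_mul, abs_inv, abs_of_pos hn]
  rw [div_eq_mul_inv, mul_comm (2 * C)]
  gcongr
  calc |g (n + 1) - g 0| ≤ |g (n + 1)| + |g 0| := abs_sub _ _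
    _ ≤ C + C := add_le_add (hgb _) (hgb _)
    _ = 2 * C := by ring

end Literature.Probability.RandomMatrixProducts

end



/-! ## Part C/D: stationary measures — iterated invariance, the upper Furstenberg bound, non-atomicity -/

noncomputable section

open MeasureTheory Set Filter Topology
open scoped Matrix.Norms.L2Operator ENNReal Matrix

namespace Literature.Probability.RandomMatrixProducts

local notation "𝕊" => Metric.sphere (0 : EuclideanSpace ℝ (Fin 2)) 1

local notation "Γ[" μ "]" => (2 * andersonKappa μ - 1 : ℝ)

/-! ### Iterated invariance of stationary measures -/

/-- **`n`-step invariance**: if `ν` is stationary then the chain of directions started from `ν` has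
law `ν` at every time, `∫ (∫ f(M_n(x) · v) dμ^{⊗n}(x)) dν(v) = ∫ f dν` for `f` continuous and bounded.
[cite: BucajEtAl2019, §2 (Fürstenberg's theorem: `ν_E`-stationarity)] -/
theorem IsStationaryFor.integral_integral_dirVec_eq {μ : Measure ℝ} [IsProbabilityMeasure μ] {E : ℝ}
    {ν : Measure 𝕊} [IsProbabilityMeasure ν] (h : IsStationaryFor μ E ν) :
    ∀ (n : ℕ) {f : 𝕊 → ℝ}, Continuous f → ∀ {C : ℝ}, (∀ v, |f v| ≤ C) →
      ∫ v, (∫ x, f (dirVec E n v x) ∂(Measure.pi fun _ : Fin n => μ)) ∂ν = ∫ v, f v ∂ν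
  | 0, f, _, C, _ => by
    simp only [dirVec_zero, integral_const, probReal_univ, one_smul]
  | n + 1, f, hf, C, hC => by
    have step : ∀ v : 𝕊, ∫ x, f (dirVec E (n + 1) v x) ∂(Measure.pi fun _ : Fin (n + 1) => μ) =
        ∫ x, circleMarkov μ E f (dirVec E n v x) ∂(Measure.pi fun _ : Fin n => μ) := by
      intro v
      have := integral_dirLaw_succ μ E n v hf.measurable hC
      rwa [integral_dirLaw _ _ _ _ hf.measurable.aestronglyMeasurable,
        integral_dirLaw _ _ _ _ (measurable_circleMarkov μ E hf.measurable).aestronglyMeasurable] at this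
    simp_rw [step]
    rw [IsStationaryFor.integral_integral_dirVec_eq h n (continuous_circleMarkov μ E hf hC) (abs_circleMarkov_le μ E hC)]
    exact h.integral_eq hf.measurable hC

/-- `𝔼 log ‖M_n v‖ ≤ 𝔼 log ‖M_n‖` for a unit vector. [folklore] -/
theorem integral_log_norm_apply_le_integral_log_norm {μ : Measure ℝ} [IsProbabilityMeasure μ] (hc : IsCompact μ.support)
    {E : ℝ} (hE : E ∈ Icc (-andersonKappa μ) (andersonKappa μ)) (n : ℕ) (v : 𝕊) :
    ∫ x, Real.log ‖Matrix.toEuclideanLin (andersonTransferProd E (padSeq x) n) v‖ ∂(Measure.pi fun _ : Fin n => μ) ≤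
      ∫ x, Real.log ‖andersonTransferProd E (padSeq x) n‖ ∂(Measure.pi fun _ : Fin n => μ) := by
  refine integral_mono (integrable_log_norm_apply hc hE n le_rfl (norm_coe_circle v)) (integrable_log_norm hc hE n le_rfl)
    fun x => ?_
  have hpos : 0 < ‖Matrix.toEuclideanLin (andersonTransferProd E (padSeq x) n) v‖ :=
    norm_pos_iff.mpr (toEuclideanLin_apply_ne_zero (det_andersonTransferProd_ne_zero E _ n) (coe_circle_ne_zero v))
  refine Real.log_le_log hpos ?_
  simpa [norm_coe_circle v] using norm_toEuclideanLin_apply_le (andersonTransferProd E (padSeq x) n) (v : EuclideanSpace ℝ (Fin 2))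

/-- The `n`-step average `v ↦ ∫ ψ_E(M_k(x) · v) dμ^{⊗k}` is integrable against any probability measure on
the circle (it is continuous and bounded by `log Γ`). [folklore] -/
theorem integrable_integral_circlePsi_dirVec {μ : Measure ℝ} [IsProbabilityMeasure μ] (hc : IsCompact μ.support)
    {E : ℝ} (hE : E ∈ Icc (-andersonKappa μ) (andersonKappa μ)) (ν : Measure 𝕊) [IsProbabilityMeasure ν] (k : ℕ) :
    Integrable (fun v : 𝕊 => ∫ x, circlePsi μ E (dirVec E k v x) ∂(Measure.pi fun _ : Fin k => μ)) ν :=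
  Integrable.of_bound
    (continuous_integral_dirVec μ E k (continuous_circlePsi hc E) (abs_circlePsi_le hc hE)).measurable.aestronglyMeasurable
    (Real.log Γ[μ]) (Eventually.of_forall fun v => by
      rw [Real.norm_eq_abs]; exact abs_integral_dirVec_le μ E k (abs_circlePsi_le hc hE) v)

/-- The vector log-moment `v ↦ 𝔼 log ‖M_n v‖` is integrable against any probability measure on the
circle. [folklore] -/
theorem integrable_integral_log_norm_apply {μ : Measure ℝ} [IsProbabilityMeasure μ] (hc : IsCompact μ.support)
    {E : ℝ} (hE : E ∈ Icc (-andersonKappa μ) (andersonKappa μ)) (ν : Measure 𝕊) [IsProbabilityMeasure ν] (n : ℕ) :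
    Integrable (fun v : 𝕊 => ∫ x, Real.log ‖Matrix.toEuclideanLin (andersonTransferProd E (padSeq x) n) v‖
      ∂(Measure.pi fun _ : Fin n => μ)) ν := by
  have heq : (fun v : 𝕊 => ∫ x, Real.log ‖Matrix.toEuclideanLin (andersonTransferProd E (padSeq x) n) v‖
      ∂(Measure.pi fun _ : Fin n => μ)) =
      fun v => ∑ k ∈ Finset.range n, ∫ x, circlePsi μ E (dirVec E k v x) ∂(Measure.pi fun _ : Fin k => μ) :=
    funext fun v => integral_log_norm_apply_eq_sum hc hE v n
  rw [heq]
  exact integrable_finsetSum _ fun k _ => integrable_integral_circlePsi_dirVec hc hE ν k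

/-- **Stationarity turns the vector log-moments into `n ∫ ψ_E dν`**:
`∫ 𝔼 log ‖M_n v‖ dν(v) = n ∫ ψ_E dν` for a stationary probability measure `ν`.
[cite: BucajEtAl2019, §2 (Thm 2.1 / Thm 2.5: the Lyapunov exponent through stationary measures)] -/
theorem IsStationaryFor.integral_integral_log_norm_apply_eq {μ : Measure ℝ} [IsProbabilityMeasure μ]
    (hc : IsCompact μ.support) {E : ℝ} (hE : E ∈ Icc (-andersonKappa μ) (andersonKappa μ))
    {ν : Measure 𝕊} [IsProbabilityMeasure ν] (h : IsStationaryFor μ E ν) (n : ℕ) :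
    ∫ v, (∫ x, Real.log ‖Matrix.toEuclideanLin (andersonTransferProd E (padSeq x) n) v‖
      ∂(Measure.pi fun _ : Fin n => μ)) ∂ν = n * ∫ v, circlePsi μ E v ∂ν := by
  have hterm : ∀ k, ∫ v, (∫ x, circlePsi μ E (dirVec E k v x) ∂(Measure.pi fun _ : Fin k => μ)) ∂ν = ∫ v, circlePsi μ E v ∂ν :=
    fun k => h.integral_integral_dirVec_eq k (continuous_circlePsi hc E) (abs_circlePsi_le hc hE)
  have h1 : ∀ v : 𝕊, ∫ x, Real.log ‖Matrix.toEuclideanLin (andersonTransferProd E (padSeq x) n) v‖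
      ∂(Measure.pi fun _ : Fin n => μ) =
      ∑ k ∈ Finset.range n, ∫ x, circlePsi μ E (dirVec E k v x) ∂(Measure.pi fun _ : Fin k => μ) :=
    fun v => integral_log_norm_apply_eq_sum hc hE v n
  simp_rw [h1]
  rw [integral_finsetSum _ fun k _ => integrable_integral_circlePsi_dirVec hc hE ν k]
  simp_rw [hterm]
  rw [Finset.sum_const, Finset.card_range, nsmul_eq_mul]

/-- **The upper half of Fürstenberg's formula**: for a stationary probability measure `ν`,
`∫ ψ_E dν ≤ n⁻¹ 𝔼 log ‖M_n^E‖` for every `n ≥ 1` (because `n ∫ ψ_E dν = ∫ 𝔼 log ‖M_n v‖ dν(v) ≤ 𝔼 log ‖M_n‖`).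
[cite: BucajEtAl2019, §2 (Thm 2.1 / Thm 2.5: the Lyapunov exponent through stationary measures)] -/
theorem IsStationaryFor.integral_circlePsi_le_andersonLogNormAvg {μ : Measure ℝ} [IsProbabilityMeasure μ]
    (hc : IsCompact μ.support) {E : ℝ} (hE : E ∈ Icc (-andersonKappa μ) (andersonKappa μ))
    {ν : Measure 𝕊} [IsProbabilityMeasure ν] (h : IsStationaryFor μ E ν) {n : ℕ} (hn : 1 ≤ n) :
    ∫ v, circlePsi μ E v ∂ν ≤ andersonLogNormAvg μ E n := by
  have hsum := h.integral_integral_log_norm_apply_eq hc hE n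
  have hLint := integrable_integral_log_norm_apply hc hE ν n
  -- ∫ 𝔼 log ‖M_n v‖ dν(v) ≤ 𝔼 log ‖M_n‖
  have hle : ∫ v, (∫ x, Real.log ‖Matrix.toEuclideanLin (andersonTransferProd E (padSeq x) n) v‖
      ∂(Measure.pi fun _ : Fin n => μ)) ∂ν ≤ ∫ x, Real.log ‖andersonTransferProd E (padSeq x) n‖ ∂(Measure.pi fun _ : Fin n => μ) := by
    have h2 := integral_mono hLint (integrable_const _) fun v => integral_log_norm_apply_le_integral_log_norm hc hE n v
    rwa [integral_const, probReal_univ, one_smul] at h2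
  have hn' : (0 : ℝ) < n := by exact_mod_cast hn
  have havg : ∫ x, Real.log ‖andersonTransferProd E (padSeq x) n‖ ∂(Measure.pi fun _ : Fin n => μ) =
      n * andersonLogNormAvg μ E n := by
    unfold andersonLogNormAvg
    field_simp
  rw [hsum, havg] at hle
  exact le_of_mul_le_mul_left hle hn'

/-- **`∫ ψ_E dν ≤ L(E)`** for every stationary probability measure `ν` (the upper half of
Fürstenberg's formula). [cite: BucajEtAl2019, §2 (Thm 2.1 / Thm 2.5)] -/
theorem IsStationaryFor.integral_circlePsi_le_andersonLyapunov {μ : Measure ℝ} [IsProbabilityMeasure μ]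
    (hc : IsCompact μ.support) {E : ℝ} (hE : E ∈ Icc (-andersonKappa μ) (andersonKappa μ))
    {ν : Measure 𝕊} [IsProbabilityMeasure ν] (h : IsStationaryFor μ E ν) :
    ∫ v, circlePsi μ E v ∂ν ≤ andersonLyapunov μ E :=
  le_ciInf fun n => h.integral_circlePsi_le_andersonLogNormAvg hc hE (Nat.succ_pos n)

/-! ### Non-atomicity of stationary measures -/

/-- The inverse of a transfer matrix: `M^E(a)⁻¹ = [[0, 1],[-1, E - a]]`. [folklore] -/
theorem andersonTransfer_inv (E a : ℝ) : (andersonTransfer E a)⁻¹ = !![0, 1; -1, E - a] := by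
  apply Matrix.inv_eq_left_inv
  ext i j
  fin_cases i <;> fin_cases j <;> simp [andersonTransfer, Matrix.mul_apply, Fin.sum_univ_two]

/-- `det M^E(a) ≠ 0`. [folklore] -/
theorem det_andersonTransfer_ne_zero (E a : ℝ) : (andersonTransfer E a).det ≠ 0 := by
  rw [det_andersonTransfer]; exact one_ne_zero

/-- `det (M^E(a))⁻¹ ≠ 0`. [folklore] -/
theorem det_andersonTransfer_inv_ne_zero (E a : ℝ) : (andersonTransfer E a)⁻¹.det ≠ 0 := by
  rw [andersonTransfer_inv]; simp [Matrix.det_fin_two_of]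

/-- **The shear in the group**: `M^E(a) (M^E(b))⁻¹ = [[1, b - a],[0, 1]]` (the unipotent matrix `A` of the
proof of Bucaj et al. Thm 2.3, whose powers show non-compactness and whose only invariant direction is
`e₁`). [cite: BucajEtAl2019, Thm 2.3 (proof)] -/
theorem andersonTransfer_mul_inv (E a b : ℝ) :
    andersonTransfer E a * (andersonTransfer E b)⁻¹ = !![1, b - a; 0, 1] := by
  rw [andersonTransfer_inv]
  ext i j
  fin_cases i <;> fin_cases j <;> simp [andersonTransfer, Matrix.mul_apply, Fin.sum_univ_two]

/-- Coordinates of the action: `(M · v)_i = (M v)_i / ‖M v‖`. [folklore] -/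
theorem projAct_apply_coord {M : Matrix (Fin 2) (Fin 2) ℝ} (hM : M.det ≠ 0) (v : 𝕊) (i : Fin 2) :
    (projAct M v : EuclideanSpace ℝ (Fin 2)) i =
      (‖Matrix.toEuclideanLin M v‖)⁻¹ * (M i 0 * (v : EuclideanSpace ℝ (Fin 2)) 0 + M i 1 * (v : EuclideanSpace ℝ (Fin 2)) 1) := by
  rw [coe_projAct_of_det hM, PiLp.smul_apply, smul_eq_mul, toEuclideanLin_apply_two]

/-- A point of the circle has `v₀² + v₁² = 1`. [folklore] -/
theorem circle_coord_sq_add_sq (v : 𝕊) :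
    (v : EuclideanSpace ℝ (Fin 2)) 0 ^ 2 + (v : EuclideanSpace ℝ (Fin 2)) 1 ^ 2 = 1 := by
  have h := norm_coe_circle v
  have hns : ‖(v : EuclideanSpace ℝ (Fin 2))‖ ^ 2 = (v : EuclideanSpace ℝ (Fin 2)) 0 ^ 2 + (v : EuclideanSpace ℝ (Fin 2)) 1 ^ 2 := by
    rw [EuclideanSpace.norm_sq_eq]; simp [Fin.sum_univ_two]
  rw [← hns, h, one_pow]

/-- **A shear has no finite invariant set of directions off the axis**: if `c ≠ 0` and a finite set
`F` of directions is mapped into itself by `[[1, c],[0, 1]]`, then every `v ∈ F` has `v₁ = 0`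
(the slope `v₀/v₁` is translated by `c`). [cite: BucajEtAl2019, Thm 2.3 (proof: `A V₁ = V₁`, `AⁿV → V₁`)] -/
theorem coord_one_eq_zero_of_shear_mapsTo {c : ℝ} (hc : c ≠ 0) (F : Finset 𝕊)
    (hF : ∀ v ∈ F, projAct !![1, c; 0, 1] v ∈ F) : ∀ v ∈ F, (v : EuclideanSpace ℝ (Fin 2)) 1 = 0 := by
  classical
  set T : Matrix (Fin 2) (Fin 2) ℝ := !![1, c; 0, 1] with hT
  have hTdet : T.det ≠ 0 := by simp [hT, Matrix.det_fin_two_of]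
  -- the slope and its translation law
  let s : 𝕊 → ℝ := fun v => (v : EuclideanSpace ℝ (Fin 2)) 0 / (v : EuclideanSpace ℝ (Fin 2)) 1
  have hcoord1 : ∀ v : 𝕊, (projAct T v : EuclideanSpace ℝ (Fin 2)) 1 =
      (‖Matrix.toEuclideanLin T v‖)⁻¹ * (v : EuclideanSpace ℝ (Fin 2)) 1 := by
    intro v; rw [projAct_apply_coord hTdet]; simp [hT]
  have hcoord0 : ∀ v : 𝕊, (projAct T v : EuclideanSpace ℝ (Fin 2)) 0 =
      (‖Matrix.toEuclideanLin T v‖)⁻¹ * ((v : EuclideanSpace ℝ (Fin 2)) 0 + c * (v : EuclideanSpace ℝ (Fin 2)) 1) := by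
    intro v; rw [projAct_apply_coord hTdet]; simp [hT]
  have hr : ∀ v : 𝕊, 0 < ‖Matrix.toEuclideanLin T v‖ := fun v =>
    norm_pos_iff.mpr (toEuclideanLin_apply_ne_zero hTdet (coe_circle_ne_zero v))
  have hne : ∀ v : 𝕊, (v : EuclideanSpace ℝ (Fin 2)) 1 ≠ 0 → (projAct T v : EuclideanSpace ℝ (Fin 2)) 1 ≠ 0 := by
    intro v hv
    rw [hcoord1]
    exact mul_ne_zero (inv_ne_zero (hr v).ne') hv
  have hslope : ∀ v : 𝕊, (v : EuclideanSpace ℝ (Fin 2)) 1 ≠ 0 → s (projAct T v) = s v + c := by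
    intro v hv
    show (projAct T v : EuclideanSpace ℝ (Fin 2)) 0 / (projAct T v : EuclideanSpace ℝ (Fin 2)) 1 =
      (v : EuclideanSpace ℝ (Fin 2)) 0 / (v : EuclideanSpace ℝ (Fin 2)) 1 + c
    rw [hcoord0, hcoord1]
    have hr' : ‖Matrix.toEuclideanLin T v‖ ≠ 0 := (hr v).ne'
    field_simp
  -- the off-axis part of F
  set F' := F.filter (fun v : 𝕊 => (v : EuclideanSpace ℝ (Fin 2)) 1 ≠ 0) with hF'
  have hmaps : ∀ v ∈ F', projAct T v ∈ F' := by
    intro v hv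
    rw [hF', Finset.mem_filter] at hv ⊢
    exact ⟨hF v hv.1, hne v hv.2⟩
  intro v₀ hv₀
  by_contra hv₀1
  have hne' : F'.Nonempty := ⟨v₀, by rw [hF', Finset.mem_filter]; exact ⟨hv₀, hv₀1⟩⟩
  rcases lt_or_gt_of_ne hc with hneg | hpos
  · obtain ⟨v, hv, hmin⟩ := Finset.exists_min_image F' s hne'
    have hv1 : (v : EuclideanSpace ℝ (Fin 2)) 1 ≠ 0 := by rw [hF', Finset.mem_filter] at hv; exact hv.2
    have h1 := hmin _ (hmaps v hv)
    rw [hslope v hv1] at h1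
    linarith
  · obtain ⟨v, hv, hmax⟩ := Finset.exists_max_image F' s hne'
    have hv1 : (v : EuclideanSpace ℝ (Fin 2)) 1 ≠ 0 := by rw [hF', Finset.mem_filter] at hv; exact hv.2
    have h1 := hmax _ (hmaps v hv)
    rw [hslope v hv1] at h1
    linarith

/-- Singletons of the circle are measurable. [folklore] -/
theorem measurableSet_singleton_circle (p : 𝕊) : MeasurableSet ({p} : Set 𝕊) := measurableSet_singleton p

/-- **Maximal atoms**: a finite measure with an atom has a finite non-empty set `F` of atoms of maximal
mass `M > 0`. [folklore] -/
theorem exists_finset_maximal_atoms (ν : Measure 𝕊) [IsFiniteMeasure ν] {p : 𝕊} (hp : ν {p} ≠ 0) :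
    ∃ (F : Finset 𝕊) (M : ℝ≥0∞), F.Nonempty ∧ (∀ v, ν {v} ≤ M) ∧ (∀ v, v ∈ F ↔ ν {v} = M) := by
  classical
  set m : ℝ≥0∞ := ⨆ v : 𝕊, ν {v} with hm
  have hm_le : ∀ v, ν {v} ≤ m := fun v => le_iSup (fun v : 𝕊 => ν {v}) v
  have hm_top : m ≠ ∞ := ne_top_of_le_ne_top (measure_ne_top ν Set.univ) (iSup_le fun v => measure_mono (subset_univ _))
  have hm0 : m ≠ 0 := fun h0 => hp (le_antisymm (h0 ▸ hm_le p) bot_le)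
  have hhalf : m / 2 < m := ENNReal.half_lt_self hm0 hm_top
  have hhalf0 : 0 < m / 2 := ENNReal.div_pos hm0 (by norm_num)
  -- the atoms of mass > m/2 form a finite non-empty set
  have hfin : Set.Finite {v : 𝕊 | m / 2 ≤ ν {v}} := by
    refine Measure.finite_const_le_meas_of_disjoint_iUnion ν hhalf0 (As := fun v : 𝕊 => ({v} : Set 𝕊))
      (fun v => measurableSet_singleton v) ?_ (measure_ne_top ν _)
    intro v w hvw
    exact Set.disjoint_singleton.mpr hvw
  obtain ⟨v₁, hv₁⟩ : ∃ v, m / 2 < ν {v} := lt_iSup_iff.mp hhalf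
  set A : Finset 𝕊 := hfin.toFinset with hA
  have hv₁A : v₁ ∈ A := by rw [hA, Set.Finite.mem_toFinset]; exact hv₁.le
  have hAne : A.Nonempty := ⟨v₁, hv₁A⟩
  obtain ⟨v₂, hv₂A, hv₂max⟩ := Finset.exists_max_image A (fun v => ν {v}) hAne
  set M : ℝ≥0∞ := ν {v₂} with hM
  have hMge : m / 2 < M := lt_of_lt_of_le hv₁ (hv₂max v₁ hv₁A)
  have hmax : ∀ v, ν {v} ≤ M := by
    intro v
    by_cases hv : v ∈ A
    · exact hv₂max v hv
    · rw [hA, Set.Finite.mem_toFinset] at hv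
      simp only [Set.mem_setOf_eq, not_le] at hv
      exact (hv.trans hMge).le
  refine ⟨A.filter (fun v => ν {v} = M), M, ⟨v₂, ?_⟩, hmax, fun v => ?_⟩
  · rw [Finset.mem_filter]; exact ⟨hv₂A, rfl⟩
  · rw [Finset.mem_filter, hA, Set.Finite.mem_toFinset]
    simp only [Set.mem_setOf_eq]
    constructor
    · exact fun h => h.2
    · intro h
      exact ⟨by rw [h]; exact hMge.le, h⟩

/-- **Stationarity transports maximal atoms**: if `ν` is stationary, `ν{v} ≤ M` for all `v` and
`ν{p} = M`, then `ν{(M^E(a))⁻¹ · p} = M` for `μ`-almost every `a`. [cite: BucajEtAl2019, Thm 2.3 (proof) / §2 (Fürstenberg)] -/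
theorem IsStationaryFor.ae_measure_projAct_inv_eq {μ : Measure ℝ} [IsProbabilityMeasure μ] {E : ℝ}
    {ν : Measure 𝕊} [IsProbabilityMeasure ν] (h : IsStationaryFor μ E ν) {M : ℝ≥0∞}
    (hmax : ∀ v, ν {v} ≤ M) {p : 𝕊} (hp : ν {p} = M) :
    ∀ᵐ a ∂μ, ν {projAct (andersonTransfer E a)⁻¹ p} = M := by
  have hstat := h.measure_eq (measurableSet_singleton_circle p)
  have hre : ∀ a : ℝ, ν ((fun v => projAct (andersonTransfer E a) v) ⁻¹' {p}) = ν {projAct (andersonTransfer E a)⁻¹ p} := by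
    intro a
    have := projAct_preimage_singleton (det_andersonTransfer_ne_zero E a) p
    rw [show (fun v => projAct (andersonTransfer E a) v) = projAct (andersonTransfer E a) from rfl, this]
  simp_rw [hre] at hstat
  -- g ≤ M everywhere and ∫ g = M = ∫ M: g = M a.e.
  set g : ℝ → ℝ≥0∞ := fun a => ν {projAct (andersonTransfer E a)⁻¹ p} with hg
  have hle : g ≤ᵐ[μ] fun _ => M := Eventually.of_forall fun a => hmax _
  have hfin : ∫⁻ a, g a ∂μ ≠ ∞ := by rw [hg, ← hstat]; exact measure_ne_top ν _
  have hgf : ∫⁻ _a, M ∂μ ≤ ∫⁻ a, g a ∂μ := by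
    rw [lintegral_const, measure_univ, mul_one, hg, ← hstat, hp]
  have hae := ae_eq_of_ae_le_of_lintegral_le hle hfin aemeasurable_const hgf
  filter_upwards [hae] with a ha
  exact ha

/-- `a ↦ (M^E(a))⁻¹ · p` is continuous. [folklore] -/
theorem continuous_projAct_andersonTransfer_inv (E : ℝ) (p : 𝕊) :
    Continuous fun a : ℝ => projAct (andersonTransfer E a)⁻¹ p := by
  have heq : (fun a : ℝ => projAct (andersonTransfer E a)⁻¹ p) = fun a : ℝ => projAct !![0, 1; -1, E - a] p := by
    funext a; rw [andersonTransfer_inv]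
  rw [heq]
  refine continuous_projAct_of (v := fun _ => p) ?_ fun a => toEuclideanLin_apply_ne_zero (by simp [Matrix.det_fin_two_of]) (coe_circle_ne_zero p)
  refine continuous_toEuclideanLin_apply (fun i j => ?_) continuous_const
  fin_cases i <;> fin_cases j <;> simp <;> fun_prop

/-- **Stationary measures of the Anderson model have no atoms** (the single-site law having at least
two points in its support): the set of atoms of maximal mass would be finite, non-empty and invariant
under `(M^E(a))⁻¹` for every `a` in the support, hence under the shear `M^E(a) (M^E(b))⁻¹ = [[1, b-a],[0,1]]`
(`a ≠ b` in the support), so contained in `{±e₁}`; but `(M^E(a))⁻¹ e₁ = -e₂`. This is the strong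
irreducibility of `G_{ν_E}` of Bucaj et al. Thm 2.3 in the form needed for Fürstenberg's formula.
[cite: BucajEtAl2019, Thm 2.3] -/
theorem IsStationaryFor.measure_singleton_eq_zero {μ : Measure ℝ} [IsProbabilityMeasure μ] {E : ℝ}
    {ν : Measure 𝕊} [IsProbabilityMeasure ν] (h : IsStationaryFor μ E ν) (hnt : μ.support.Nontrivial) (p : 𝕊) :
    ν {p} = 0 := by
  classical
  by_contra hp
  obtain ⟨F, M, hFne, hmax, hF⟩ := exists_finset_maximal_atoms ν hp
  -- invariance of F under (M^E(a))⁻¹ for a in the support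
  have hinv : ∀ a ∈ μ.support, ∀ q ∈ F, projAct (andersonTransfer E a)⁻¹ q ∈ F := by
    intro a ha q hq
    have hq' : ν {q} = M := (hF q).mp hq
    have hae := h.ae_measure_projAct_inv_eq hmax hq'
    have hclosed : IsClosed {b : ℝ | projAct (andersonTransfer E b)⁻¹ q ∈ (F : Set 𝕊)} :=
      (F.finite_toSet.isClosed).preimage (continuous_projAct_andersonTransfer_inv E q)
    have hmem : {b : ℝ | projAct (andersonTransfer E b)⁻¹ q ∈ (F : Set 𝕊)} ∈ ae μ := by
      filter_upwards [hae] with b hb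
      show projAct (andersonTransfer E b)⁻¹ q ∈ (F : Set 𝕊)
      exact Finset.mem_coe.mpr ((hF _).mpr hb)
    have hsub := Measure.support_subset_of_isClosed hclosed hmem
    simpa using hsub ha
  -- hence F is mapped onto itself by (M^E(a))⁻¹, and M^E(a) maps F into F
  have hfwd : ∀ a ∈ μ.support, ∀ r ∈ F, projAct (andersonTransfer E a) r ∈ F := by
    intro a ha r hr
    have himage : F.image (fun q => projAct (andersonTransfer E a)⁻¹ q) = F := by
      apply Finset.eq_of_subset_of_card_le
      · intro x hx
        rw [Finset.mem_image] at hx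
        obtain ⟨q, hq, rfl⟩ := hx
        exact hinv a ha q hq
      · rw [Finset.card_image_of_injective _ (projAct_injective (det_andersonTransfer_inv_ne_zero E a))]
    have hr' : r ∈ F.image (fun q => projAct (andersonTransfer E a)⁻¹ q) := by rw [himage]; exact hr
    rw [Finset.mem_image] at hr'
    obtain ⟨q, hq, rfl⟩ := hr'
    rw [projAct_mul_inv_cancel (det_andersonTransfer_ne_zero E a)]
    exact hq
  -- the shear M^E(a) (M^E(b))⁻¹ maps F into F
  obtain ⟨a, ha, b, hb, hab⟩ := hnt
  have hshear : ∀ v ∈ F, projAct !![1, b - a; 0, 1] v ∈ F := by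
    intro v hv
    rw [← andersonTransfer_mul_inv E a b, projAct_mul (det_andersonTransfer_ne_zero E a) (det_andersonTransfer_inv_ne_zero E b)]
    exact hfwd a ha _ (hinv b hb v hv)
  have haxis := coord_one_eq_zero_of_shear_mapsTo (sub_ne_zero.mpr (Ne.symm hab)) F hshear
  -- but (M^E(a))⁻¹ moves the axis off the axis
  obtain ⟨q, hq⟩ := hFne
  have hq1 : (q : EuclideanSpace ℝ (Fin 2)) 1 = 0 := haxis q hq
  have hq0 : (q : EuclideanSpace ℝ (Fin 2)) 0 ≠ 0 := by
    intro h0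
    have := circle_coord_sq_add_sq q
    rw [h0, hq1] at this
    norm_num at this
  have himg := haxis _ (hinv a ha q hq)
  rw [projAct_apply_coord (det_andersonTransfer_inv_ne_zero E a), andersonTransfer_inv] at himg
  simp only [Matrix.of_apply, Matrix.cons_val', Matrix.cons_val_zero, Matrix.cons_val_one,
    Matrix.cons_val_fin_one, hq1, mul_zero, add_zero] at himg
  have hr : (‖Matrix.toEuclideanLin (andersonTransfer E a)⁻¹ q‖)⁻¹ ≠ 0 :=
    inv_ne_zero (norm_pos_iff.mpr (toEuclideanLin_apply_ne_zero (det_andersonTransfer_inv_ne_zero E a) (coe_circle_ne_zero q))).ne'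
  rw [andersonTransfer_inv] at hr
  rcases mul_eq_zero.mp himg with h1 | h1
  · exact hr h1
  · exact hq0 (by linarith)

/-- Non-atomicity on finite sets. [folklore] -/
theorem IsStationaryFor.measure_finset_eq_zero {μ : Measure ℝ} [IsProbabilityMeasure μ] {E : ℝ}
    {ν : Measure 𝕊} [IsProbabilityMeasure ν] (h : IsStationaryFor μ E ν) (hnt : μ.support.Nontrivial) (F : Finset 𝕊) :
    ν (F : Set 𝕊) = 0 := by
  classical
  induction F using Finset.induction_on with
  | empty => simp
  | insert a s has ih =>
    rw [Finset.coe_insert, Set.insert_eq]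
    refine le_antisymm ((measure_union_le ({a} : Set 𝕊) (s : Set 𝕊)).trans ?_) bot_le
    rw [h.measure_singleton_eq_zero hnt a, ih, add_zero]

end Literature.Probability.RandomMatrixProducts

end



/-! ## Part E: thin bands of a non-atomic measure, the larger-row lower bound, Fürstenberg's formula -/

noncomputable section

open MeasureTheory Set Filter Topology
open scoped Matrix.Norms.L2Operator ENNReal Matrix

namespace Literature.Probability.RandomMatrixProducts

local notation "𝕊" => Metric.sphere (0 : EuclideanSpace ℝ (Fin 2)) 1

local notation "Γ[" μ "]" => (2 * andersonKappa μ - 1 : ℝ)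

/-! ### Coordinates on the circle -/

/-- `|a_i| ≤ ‖a‖` in `ℝ²`. [folklore] -/
theorem abs_coord_le_norm (a : EuclideanSpace ℝ (Fin 2)) (i : Fin 2) : |a i| ≤ ‖a‖ := by
  have hns : ‖a‖ ^ 2 = a 0 ^ 2 + a 1 ^ 2 := by
    rw [EuclideanSpace.norm_sq_eq]; simp [Fin.sum_univ_two]
  refine abs_le_of_sq_le_sq ?_ (norm_nonneg a)
  fin_cases i
  · show a 0 ^ 2 ≤ ‖a‖ ^ 2
    nlinarith [sq_nonneg (a 1)]
  · show a 1 ^ 2 ≤ ‖a‖ ^ 2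
    nlinarith [sq_nonneg (a 0)]

/-- On the circle `|v_i| ≤ 1`. [folklore] -/
theorem abs_coord_le_one (v : 𝕊) (i : Fin 2) : |(v : EuclideanSpace ℝ (Fin 2)) i| ≤ 1 := by
  simpa [norm_coe_circle v] using abs_coord_le_norm (v : EuclideanSpace ℝ (Fin 2)) i

/-- The dot product `u₀ v₀ + u₁ v₁` is `2`-Lipschitz in `u` for `v` on the circle:
`|u·v - u'·v| ≤ 2 ‖u - u'‖`. [folklore] -/
theorem abs_dot_sub_dot_le (u u' : EuclideanSpace ℝ (Fin 2)) (v : 𝕊) :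
    |(u 0 * (v : EuclideanSpace ℝ (Fin 2)) 0 + u 1 * (v : EuclideanSpace ℝ (Fin 2)) 1) -
      (u' 0 * (v : EuclideanSpace ℝ (Fin 2)) 0 + u' 1 * (v : EuclideanSpace ℝ (Fin 2)) 1)| ≤ 2 * ‖u - u'‖ := by
  have h0 := abs_coord_le_norm (u - u') 0
  have h1 := abs_coord_le_norm (u - u') 1
  simp only [PiLp.sub_apply] at h0 h1
  have hv0 := abs_coord_le_one v 0
  have hv1 := abs_coord_le_one v 1
  calc |(u 0 * (v : EuclideanSpace ℝ (Fin 2)) 0 + u 1 * (v : EuclideanSpace ℝ (Fin 2)) 1) -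
        (u' 0 * (v : EuclideanSpace ℝ (Fin 2)) 0 + u' 1 * (v : EuclideanSpace ℝ (Fin 2)) 1)|
      = |(u 0 - u' 0) * (v : EuclideanSpace ℝ (Fin 2)) 0 + (u 1 - u' 1) * (v : EuclideanSpace ℝ (Fin 2)) 1| := by ring_nf
    _ ≤ |(u 0 - u' 0) * (v : EuclideanSpace ℝ (Fin 2)) 0| + |(u 1 - u' 1) * (v : EuclideanSpace ℝ (Fin 2)) 1| := abs_add_le _ _
    _ = |u 0 - u' 0| * |(v : EuclideanSpace ℝ (Fin 2)) 0| + |u 1 - u' 1| * |(v : EuclideanSpace ℝ (Fin 2)) 1| := by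
        rw [abs_mul, abs_mul]
    _ ≤ ‖u - u'‖ * 1 + ‖u - u'‖ * 1 := by gcongr
    _ = 2 * ‖u - u'‖ := by ring

/-- The perpendicular direction `(-u₁, u₀)` of a point `u` of the circle. [folklore] -/
def circlePerp (u : 𝕊) : 𝕊 :=
  ⟨WithLp.toLp 2 ![-(u : EuclideanSpace ℝ (Fin 2)) 1, (u : EuclideanSpace ℝ (Fin 2)) 0], by
    rw [mem_sphere_zero_iff_norm]
    have h : ‖(WithLp.toLp 2 ![-(u : EuclideanSpace ℝ (Fin 2)) 1, (u : EuclideanSpace ℝ (Fin 2)) 0] : EuclideanSpace ℝ (Fin 2))‖ ^ 2 = 1 := by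
      rw [EuclideanSpace.norm_sq_eq]
      simp [Fin.sum_univ_two]
      have := circle_coord_sq_add_sq u
      nlinarith
    have h0 : 0 ≤ ‖(WithLp.toLp 2 ![-(u : EuclideanSpace ℝ (Fin 2)) 1, (u : EuclideanSpace ℝ (Fin 2)) 0] : EuclideanSpace ℝ (Fin 2))‖ :=
      norm_nonneg _
    nlinarith⟩

/-- The antipode of a point of the circle. [folklore] -/
def circleNeg (u : 𝕊) : 𝕊 := ⟨-(u : EuclideanSpace ℝ (Fin 2)), by rw [mem_sphere_zero_iff_norm, norm_neg, norm_coe_circle u]⟩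

/-- **The orthogonal directions of `u` on the circle are `±u⊥`.** [folklore] -/
theorem dot_eq_zero_iff_subset (u : 𝕊) :
    {v : 𝕊 | (u : EuclideanSpace ℝ (Fin 2)) 0 * (v : EuclideanSpace ℝ (Fin 2)) 0 +
      (u : EuclideanSpace ℝ (Fin 2)) 1 * (v : EuclideanSpace ℝ (Fin 2)) 1 = 0} ⊆
      {circlePerp u, circleNeg (circlePerp u)} := by
  intro v hv
  simp only [Set.mem_setOf_eq] at hv
  set u0 := (u : EuclideanSpace ℝ (Fin 2)) 0 with hu0
  set u1 := (u : EuclideanSpace ℝ (Fin 2)) 1 with hu1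
  set v0 := (v : EuclideanSpace ℝ (Fin 2)) 0 with hv0
  set v1 := (v : EuclideanSpace ℝ (Fin 2)) 1 with hv1
  have hu := circle_coord_sq_add_sq u
  have hvv := circle_coord_sq_add_sq v
  rw [← hu0, ← hu1] at hu
  rw [← hv0, ← hv1] at hvv
  set lam := u0 * v1 - u1 * v0 with hlam
  have e0 : v0 = -(lam * u1) := by linear_combination u0 * hv - v0 * hu
  have e1 : v1 = lam * u0 := by linear_combination u1 * hv - v1 * hu
  have hl : lam * lam = 1 := by linear_combination (-(u0 * v0 + u1 * v1)) * hv + (v0 ^ 2 + v1 ^ 2) * hu + hvv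
  rcases mul_self_eq_one_iff.mp hl with h1 | h1
  · left
    apply Subtype.ext
    apply PiLp.ext
    intro i
    fin_cases i
    · show v0 = (WithLp.toLp 2 ![-u1, u0] : EuclideanSpace ℝ (Fin 2)) 0
      simp [e0, h1]
    · show v1 = (WithLp.toLp 2 ![-u1, u0] : EuclideanSpace ℝ (Fin 2)) 1
      simp [e1, h1]
  · right
    apply Subtype.ext
    apply PiLp.ext
    intro i
    fin_cases i
    · show v0 = (-(WithLp.toLp 2 ![-u1, u0] : EuclideanSpace ℝ (Fin 2))) 0
      simp [e0, h1]
    · show v1 = (-(WithLp.toLp 2 ![-u1, u0] : EuclideanSpace ℝ (Fin 2))) 1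
      simp [e1, h1]

/-- A non-atomic measure on the circle gives no mass to the two directions orthogonal to `u`. [folklore] -/
theorem measure_dot_eq_zero (ν : Measure 𝕊) (hna : ∀ p, ν {p} = 0) (u : 𝕊) :
    ν {v : 𝕊 | (u : EuclideanSpace ℝ (Fin 2)) 0 * (v : EuclideanSpace ℝ (Fin 2)) 0 +
      (u : EuclideanSpace ℝ (Fin 2)) 1 * (v : EuclideanSpace ℝ (Fin 2)) 1 = 0} = 0 := by
  refine measure_mono_null (dot_eq_zero_iff_subset u) ?_
  rw [Set.insert_eq]
  refine le_antisymm ((measure_union_le _ _).trans ?_) bot_le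
  rw [hna, hna, add_zero]

/-- The closed band `{v : |u·v| ≤ r}` is closed, hence measurable. [folklore] -/
theorem measurableSet_band_le (u : EuclideanSpace ℝ (Fin 2)) (r : ℝ) :
    MeasurableSet {v : 𝕊 | |u 0 * (v : EuclideanSpace ℝ (Fin 2)) 0 + u 1 * (v : EuclideanSpace ℝ (Fin 2)) 1| ≤ r} := by
  refine (isClosed_le ?_ continuous_const).measurableSet
  have h : ∀ i, Continuous fun v : 𝕊 => (v : EuclideanSpace ℝ (Fin 2)) i := fun i =>
    (continuous_apply i).comp ((PiLp.continuous_ofLp 2 _).comp continuous_subtype_val)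
  exact ((continuous_const.mul (h 0)).add (continuous_const.mul (h 1))).abs

/-- The open band `{v : |u·v| < r}` is open, hence measurable. [folklore] -/
theorem measurableSet_band_lt (u : EuclideanSpace ℝ (Fin 2)) (r : ℝ) :
    MeasurableSet {v : 𝕊 | |u 0 * (v : EuclideanSpace ℝ (Fin 2)) 0 + u 1 * (v : EuclideanSpace ℝ (Fin 2)) 1| < r} := by
  refine (isOpen_lt ?_ continuous_const).measurableSet
  have h : ∀ i, Continuous fun v : 𝕊 => (v : EuclideanSpace ℝ (Fin 2)) i := fun i =>
    (continuous_apply i).comp ((PiLp.continuous_ofLp 2 _).comp continuous_subtype_val)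
  exact ((continuous_const.mul (h 0)).add (continuous_const.mul (h 1))).abs

/-- **Thin bands of a non-atomic measure are uniformly small**: if `ν` is a finite measure on the
circle without atoms, then for every `δ > 0` there is `r > 0` with `ν{v : |u·v| < r} ≤ δ` for EVERY
direction `u` (compactness of the circle and `ν{v : u·v = 0} = ν{±u⊥} = 0`). [folklore] -/
theorem exists_radius_measure_band_le (ν : Measure 𝕊) [IsFiniteMeasure ν] (hna : ∀ p, ν {p} = 0)
    {δ : ℝ≥0∞} (hδ : 0 < δ) :
    ∃ r : ℝ, 0 < r ∧ ∀ u : 𝕊,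
      ν {v : 𝕊 | |(u : EuclideanSpace ℝ (Fin 2)) 0 * (v : EuclideanSpace ℝ (Fin 2)) 0 +
        (u : EuclideanSpace ℝ (Fin 2)) 1 * (v : EuclideanSpace ℝ (Fin 2)) 1| < r} ≤ δ := by
  by_contra hcon
  simp only [not_exists, not_and, not_forall, not_le] at hcon
  -- a sequence of bad directions at scales 1/(k+1)
  choose u hu using fun k : ℕ => hcon (1 / ((k : ℝ) + 1)) (by positivity)
  obtain ⟨w, -, φ, hφ, hlim⟩ := isCompact_univ.tendsto_subseq (x := u) fun k => mem_univ (u k)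
  -- notation for bands around the limit direction
  set d : 𝕊 → ℝ := fun v => (w : EuclideanSpace ℝ (Fin 2)) 0 * (v : EuclideanSpace ℝ (Fin 2)) 0 +
    (w : EuclideanSpace ℝ (Fin 2)) 1 * (v : EuclideanSpace ℝ (Fin 2)) 1 with hd
  have hband : ∀ s : ℝ, 0 < s → δ < ν {v : 𝕊 | |d v| ≤ s} := by
    intro s hs
    -- for k large: 1/(φ k + 1) ≤ s/2 and ‖u (φ k) - w‖ ≤ s/4
    have hdist : ∀ᶠ k in atTop, dist (u (φ k)) w < s / 4 := by
      have := (Metric.tendsto_nhds.mp hlim) (s / 4) (by positivity)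
      exact this
    have hsmall : ∀ᶠ k : ℕ in atTop, 1 / ((φ k : ℝ) + 1) ≤ s / 2 := by
      have hφt : Tendsto (fun k => (φ k : ℝ)) atTop atTop :=
        tendsto_natCast_atTop_atTop.comp hφ.tendsto_atTop
      have h2 : Tendsto (fun k => 1 / ((φ k : ℝ) + 1)) atTop (𝓝 0) := by
        have := (tendsto_one_div_add_atTop_nhds_zero_nat (𝕜 := ℝ)).comp hφ.tendsto_atTop
        exact this
      exact (h2.eventually (ge_mem_nhds (by positivity : (0 : ℝ) < s / 2))).mono fun k hk => hk
    obtain ⟨k, hk1, hk2⟩ := (hdist.and hsmall).exists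
    refine (hu (φ k)).trans_le (measure_mono fun v hv => ?_)
    simp only [Set.mem_setOf_eq] at hv ⊢
    have hlip := abs_dot_sub_dot_le (u (φ k) : EuclideanSpace ℝ (Fin 2)) (w : EuclideanSpace ℝ (Fin 2)) v
    have hdist' : ‖(u (φ k) : EuclideanSpace ℝ (Fin 2)) - (w : EuclideanSpace ℝ (Fin 2))‖ < s / 4 := by
      rw [← dist_eq_norm]; exact hk1
    rw [hd]
    have := abs_sub_abs_le_abs_sub
      ((w : EuclideanSpace ℝ (Fin 2)) 0 * (v : EuclideanSpace ℝ (Fin 2)) 0 + (w : EuclideanSpace ℝ (Fin 2)) 1 * (v : EuclideanSpace ℝ (Fin 2)) 1)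
      ((u (φ k) : EuclideanSpace ℝ (Fin 2)) 0 * (v : EuclideanSpace ℝ (Fin 2)) 0 + (u (φ k) : EuclideanSpace ℝ (Fin 2)) 1 * (v : EuclideanSpace ℝ (Fin 2)) 1)
    rw [abs_sub_comm] at hlip
    linarith
  -- hence ν{d = 0} ≥ δ > 0, contradicting non-atomicity
  have hzero : {v : 𝕊 | d v = 0} = ⋂ j : ℕ, {v : 𝕊 | |d v| ≤ 1 / ((j : ℝ) + 1)} := by
    ext v
    simp only [Set.mem_setOf_eq, Set.mem_iInter]
    constructor
    · intro h j; rw [h, abs_zero]; positivity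
    · intro h
      by_contra hne
      have hpos : 0 < |d v| := abs_pos.mpr hne
      obtain ⟨j, hj⟩ := exists_nat_one_div_lt hpos
      exact absurd (h j) (not_le.mpr hj)
  have hmeas : ∀ j : ℕ, MeasurableSet {v : 𝕊 | |d v| ≤ 1 / ((j : ℝ) + 1)} := fun j =>
    measurableSet_band_le (w : EuclideanSpace ℝ (Fin 2)) _
  have hanti : Antitone fun j : ℕ => {v : 𝕊 | |d v| ≤ 1 / ((j : ℝ) + 1)} := by
    intro i j hij v hv
    simp only [Set.mem_setOf_eq] at hv ⊢
    refine hv.trans ?_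
    gcongr
  have hinf : ν {v : 𝕊 | d v = 0} = ⨅ j : ℕ, ν {v : 𝕊 | |d v| ≤ 1 / ((j : ℝ) + 1)} := by
    rw [hzero]
    exact hanti.measure_iInter (fun j => (hmeas j).nullMeasurableSet) ⟨0, measure_ne_top ν _⟩
  have hge : δ ≤ ν {v : 𝕊 | d v = 0} := by
    rw [hinf]
    exact le_iInf fun j => (hband _ (by positivity)).le
  have h0 := measure_dot_eq_zero ν hna w
  rw [h0] at hge
  exact absurd hge (not_le.mpr hδ)

/-! ### The larger-row lower bound -/

/-- **Pointwise larger-row lower bound.** For a unimodular `B` there is a unit `s` such that every unit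
`w` with `|s·w| ≥ r` (`0 < r`) has `log ‖B w‖ ≥ log ‖B‖ + log r - log √2`.
[cite: BucajEtAl2019, §3 (proof of Thm 3.1: `‖M‖ ≤ √2 max_j ‖M e_j‖`, here rowwise)] -/
theorem exists_unit_log_norm_apply_ge (B : Matrix (Fin 2) (Fin 2) ℝ) (hB : B.det = 1) :
    ∃ s : EuclideanSpace ℝ (Fin 2), ‖s‖ = 1 ∧ ∀ (w : EuclideanSpace ℝ (Fin 2)), ‖w‖ = 1 → ∀ r : ℝ, 0 < r →
      r ≤ |s 0 * w 0 + s 1 * w 1| →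
        Real.log ‖B‖ + Real.log r - Real.log (Real.sqrt 2) ≤ Real.log ‖Matrix.toEuclideanLin B w‖ := by
  obtain ⟨s, hs, hrow⟩ := exists_unit_largerRow B hB
  refine ⟨s, hs, fun w hw r hr hle => ?_⟩
  have hw0 : w ≠ 0 := by
    intro h; rw [h, norm_zero] at hw; exact zero_ne_one hw
  -- some row sees `w` at angle ≥ r
  have hgood : ∃ i, (r * ‖w‖) ^ 2 * ((B 0 0 ^ 2 + B 0 1 ^ 2 + (B 1 0 ^ 2 + B 1 1 ^ 2)) / 2) ≤
      (B i 0 * w 0 + B i 1 * w 1) ^ 2 := by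
    by_contra hno
    simp only [not_exists, not_le] at hno
    rw [hw, mul_one] at hno
    have := hrow w r hr.le hno
    linarith
  obtain ⟨i, hi⟩ := hgood
  have h := log_norm_apply_ge_of_row B hB hw0 hr i hi
  rw [hw, Real.log_one] at h
  linarith

/-- **The larger-row lower bound in mean** (replacing the Bougerol–Lacroix input of Prop. 2.10 of the
source): for a probability measure `ρ` on the circle whose thin bands `{v : |u·v| < r}` all have mass
`≤ δ` (`0 < r ≤ 1`), for `E ∈ Σ̂` and a sample `x` in the support box,
`∫ log ‖M_m(x) v‖ dρ(v) ≥ log ‖M_m(x)‖ + log r - log √2 - 2δ m log Γ`. [folklore] -/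
theorem integral_log_norm_apply_ge_of_bands {μ : Measure ℝ} {E : ℝ} (hE : E ∈ Icc (-andersonKappa μ) (andersonKappa μ))
    {m : ℕ} {x : Fin m → ℝ} (hx : ∀ i, |x i| ≤ andersonKappa μ - 2)
    (ρ : Measure 𝕊) [IsProbabilityMeasure ρ] {r δ : ℝ} (hr0 : 0 < r) (hr1 : r ≤ 1) (hδ : 0 ≤ δ)
    (hband : ∀ u : 𝕊, ρ {v : 𝕊 | |(u : EuclideanSpace ℝ (Fin 2)) 0 * (v : EuclideanSpace ℝ (Fin 2)) 0 +
        (u : EuclideanSpace ℝ (Fin 2)) 1 * (v : EuclideanSpace ℝ (Fin 2)) 1| < r} ≤ ENNReal.ofReal δ) :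
    Real.log ‖andersonTransferProd E (padSeq x) m‖ + Real.log r - Real.log (Real.sqrt 2) - 2 * δ * m * Real.log Γ[μ] ≤
      ∫ v, Real.log ‖Matrix.toEuclideanLin (andersonTransferProd E (padSeq x) m) v‖ ∂ρ := by
  set B := andersonTransferProd E (padSeq x) m with hBdef
  have hBdet : B.det = 1 := det_andersonTransferProd E _ m
  obtain ⟨s, hs, hgrow⟩ := exists_unit_log_norm_apply_ge B hBdet
  set su : 𝕊 := ⟨s, mem_sphere_zero_iff_norm.mpr hs⟩ with hsu
  set lg := Real.log Γ[μ] with hlg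
  have hlg0 : 0 ≤ lg := (log_gam_pos μ).le
  have hlogB : Real.log ‖B‖ ≤ m * lg := log_norm_le_of_box hE hx m le_rfl
  have hlogB0 : 0 ≤ Real.log ‖B‖ := log_norm_andersonTransferProd_nonneg E _ m
  set X : ℝ := Real.log ‖B‖ + Real.log r - Real.log (Real.sqrt 2) with hX
  have hlogr : Real.log r ≤ 0 := Real.log_nonpos hr0.le hr1
  have hlog2 : 0 ≤ Real.log (Real.sqrt 2) := Real.log_nonneg (Real.one_le_sqrt.mpr (by norm_num))
  have hXle : X ≤ m * lg := by rw [hX]; linarith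
  set K : ℝ := max (X + m * lg) 0 with hK
  have hK0 : 0 ≤ K := le_max_right _ _
  have hKle : K ≤ 2 * m * lg := by
    rw [hK]; refine max_le ?_ (by positivity); linarith
  set band : Set 𝕊 := {v : 𝕊 | |(su : EuclideanSpace ℝ (Fin 2)) 0 * (v : EuclideanSpace ℝ (Fin 2)) 0 +
    (su : EuclideanSpace ℝ (Fin 2)) 1 * (v : EuclideanSpace ℝ (Fin 2)) 1| < r} with hband_def
  have hband_meas : MeasurableSet band := measurableSet_band_lt _ _
  -- the pointwise bound
  set f : 𝕊 → ℝ := fun v => Real.log ‖Matrix.toEuclideanLin B v‖ with hf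
  have hpt : ∀ v : 𝕊, X - K * band.indicator (1 : 𝕊 → ℝ) v ≤ f v := by
    intro v
    by_cases hv : v ∈ band
    · rw [Set.indicator_of_mem hv, Pi.one_apply, mul_one]
      have hlow : -(m * lg) ≤ f v := by
        have := abs_log_norm_apply_le_of_box hE hx (norm_coe_circle v) m le_rfl
        rw [← hlg] at this
        exact (abs_le.mp this).1
      have : X - K ≤ -(m * lg) := by
        have : X + m * lg ≤ K := le_max_left _ _
        linarith
      linarith
    · rw [Set.indicator_of_notMem hv, mul_zero, sub_zero]
      have hv' : r ≤ |s 0 * (v : EuclideanSpace ℝ (Fin 2)) 0 + s 1 * (v : EuclideanSpace ℝ (Fin 2)) 1| := by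
        rw [hband_def] at hv
        simp only [Set.mem_setOf_eq, not_lt] at hv
        exact hv
      exact hgrow (v : EuclideanSpace ℝ (Fin 2)) (norm_coe_circle v) r hr0 hv'
  -- integrate
  have hfi : Integrable f ρ := by
    refine Integrable.of_bound ?_ (m * lg) (Eventually.of_forall fun v => ?_)
    · have hcont : Continuous f := by
        refine Continuous.log ?_ fun v => (norm_pos_iff.mpr (toEuclideanLin_apply_ne_zero
          (det_andersonTransferProd_ne_zero E _ m) (coe_circle_ne_zero v))).ne'
        exact (continuous_toEuclideanLin_apply (M := fun _ : 𝕊 => B) (u := fun v : 𝕊 => (v : EuclideanSpace ℝ (Fin 2)))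
          (fun _ _ => continuous_const) continuous_subtype_val).norm
      exact hcont.measurable.aestronglyMeasurable
    · rw [Real.norm_eq_abs]
      have := abs_log_norm_apply_le_of_box hE hx (norm_coe_circle v) m le_rfl
      rwa [← hlg] at this
  have hind : Integrable (band.indicator (1 : 𝕊 → ℝ)) ρ := (integrable_const (1 : ℝ)).indicator hband_meas
  have hgi : Integrable (fun v : 𝕊 => X - K * band.indicator (1 : 𝕊 → ℝ) v) ρ :=
    (integrable_const X).sub (hind.const_mul K)
  have hmono := integral_mono hgi hfi hpt
  have hint_lower : ∫ v, (X - K * band.indicator (1 : 𝕊 → ℝ) v) ∂ρ = X - K * ρ.real band := by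
    rw [integral_sub (integrable_const X) (hind.const_mul K),
      integral_const, probReal_univ, one_smul, integral_const_mul, integral_indicator_one hband_meas]
  rw [hint_lower] at hmono
  have hreal : ρ.real band ≤ δ := ENNReal.toReal_le_of_le_ofReal hδ (hband su)
  have : X - 2 * δ * m * lg ≤ X - K * ρ.real band := by
    have h1 : K * ρ.real band ≤ K * δ := mul_le_mul_of_nonneg_left hreal hK0
    have h2 : K * δ ≤ 2 * m * lg * δ := mul_le_mul_of_nonneg_right hKle hδ
    nlinarith
  rw [hX] at this hmono
  linarith

/-- `(x, v) ↦ log ‖M_m(x) v‖` is continuous on (samples) × (circle). [folklore] -/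
theorem continuous_log_norm_transferProd_apply_uncurry (E : ℝ) (m : ℕ) :
    Continuous fun p : (Fin m → ℝ) × 𝕊 => Real.log ‖Matrix.toEuclideanLin (andersonTransferProd E (padSeq p.1) m) p.2‖ := by
  refine Continuous.log ?_ fun p => (norm_pos_iff.mpr (toEuclideanLin_apply_ne_zero
    (det_andersonTransferProd_ne_zero E _ m) (coe_circle_ne_zero p.2))).ne'
  refine (continuous_toEuclideanLin_apply (fun i j => ?_) (continuous_subtype_val.comp continuous_snd)).norm
  exact ((continuous_apply j).comp ((continuous_apply i).comp (continuous_andersonTransferProd E m))).comp continuous_fst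

/-- **The larger-row lower bound, averaged over the sample**: under the band condition,
`∫∫ log ‖M_m(x) v‖ dρ(v) dμ^{⊗m}(x) ≥ m L(E) + log r - log √2 - 2δ m log Γ`. [folklore] -/
theorem integral_integral_log_norm_apply_ge_of_bands {μ : Measure ℝ} [IsProbabilityMeasure μ] (hc : IsCompact μ.support)
    {E : ℝ} (hE : E ∈ Icc (-andersonKappa μ) (andersonKappa μ)) {m : ℕ} (hm : 1 ≤ m)
    (ρ : Measure 𝕊) [IsProbabilityMeasure ρ] {r δ : ℝ} (hr0 : 0 < r) (hr1 : r ≤ 1) (hδ : 0 ≤ δ)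
    (hband : ∀ u : 𝕊, ρ {v : 𝕊 | |(u : EuclideanSpace ℝ (Fin 2)) 0 * (v : EuclideanSpace ℝ (Fin 2)) 0 +
        (u : EuclideanSpace ℝ (Fin 2)) 1 * (v : EuclideanSpace ℝ (Fin 2)) 1| < r} ≤ ENNReal.ofReal δ) :
    m * andersonLyapunov μ E + Real.log r - Real.log (Real.sqrt 2) - 2 * δ * m * Real.log Γ[μ] ≤
      ∫ x, (∫ v, Real.log ‖Matrix.toEuclideanLin (andersonTransferProd E (padSeq x) m) v‖ ∂ρ)
        ∂(Measure.pi fun _ : Fin m => μ) := by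
  set P : Measure (Fin m → ℝ) := Measure.pi fun _ : Fin m => μ with hP
  set lg := Real.log Γ[μ] with hlg
  have hL := mul_andersonLyapunov_le_integral μ E hm
  -- integrability of the inner integral in x
  have hcont := continuous_log_norm_transferProd_apply_uncurry E m
  have hsm : StronglyMeasurable (Function.uncurry fun (x : Fin m → ℝ) (v : 𝕊) =>
      Real.log ‖Matrix.toEuclideanLin (andersonTransferProd E (padSeq x) m) v‖) := hcont.stronglyMeasurable
  have hinner_meas : AEStronglyMeasurable (fun x : Fin m → ℝ =>
      ∫ v, Real.log ‖Matrix.toEuclideanLin (andersonTransferProd E (padSeq x) m) v‖ ∂ρ) P :=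
    (hsm.integral_prod_right' (ν := ρ)).aestronglyMeasurable
  have hinner_bound : ∀ᵐ x ∂P, ‖∫ v, Real.log ‖Matrix.toEuclideanLin (andersonTransferProd E (padSeq x) m) v‖ ∂ρ‖ ≤ m * lg := by
    filter_upwards [ae_pi_abs_le_kappa_sub_two hc m] with x hx
    rw [Real.norm_eq_abs]
    refine abs_integral_le_integral_abs.trans ?_
    have h1 : ∫ v, |Real.log ‖Matrix.toEuclideanLin (andersonTransferProd E (padSeq x) m) v‖| ∂ρ ≤ ∫ _v, (m : ℝ) * lg ∂ρ :=
      integral_mono_of_nonneg (Eventually.of_forall fun v => abs_nonneg _) (integrable_const _)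
        (Eventually.of_forall fun v => abs_log_norm_apply_le_of_box hE hx (norm_coe_circle v) m le_rfl)
    refine h1.trans ?_
    rw [integral_const, probReal_univ, one_smul]
  have hinner_int : Integrable (fun x : Fin m → ℝ =>
      ∫ v, Real.log ‖Matrix.toEuclideanLin (andersonTransferProd E (padSeq x) m) v‖ ∂ρ) P :=
    Integrable.of_bound hinner_meas _ hinner_bound
  -- the pointwise bound a.e. and integration
  have hpt : ∀ᵐ x ∂P, Real.log ‖andersonTransferProd E (padSeq x) m‖ + (Real.log r - Real.log (Real.sqrt 2) - 2 * δ * m * lg) ≤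
      ∫ v, Real.log ‖Matrix.toEuclideanLin (andersonTransferProd E (padSeq x) m) v‖ ∂ρ := by
    filter_upwards [ae_pi_abs_le_kappa_sub_two hc m] with x hx
    have := integral_log_norm_apply_ge_of_bands hE hx ρ hr0 hr1 hδ hband
    rw [← hlg] at this
    linarith
  have hmono := integral_mono_ae ((integrable_log_norm hc hE m le_rfl).add (integrable_const _)) hinner_int hpt
  rw [integral_add' (integrable_log_norm hc hE m le_rfl) (integrable_const _), integral_const, probReal_univ, one_smul] at hmono
  linarith

/-! ### Fürstenberg's formula -/

/-- **The lower half of Fürstenberg's formula**: for every stationary probability measure `ν`,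
`L(E) ≤ ∫ ψ_E dν` — non-atomicity makes all thin bands uniformly small, the larger-row lower bound
gives `m ∫ ψ_E dν = ∫ 𝔼 log ‖M_m v‖ dν ≥ m L(E) + log r - log √2 - 2δ m log Γ`, and `m → ∞`, `δ → 0`.
[cite: BucajEtAl2019, §2 (Thm 2.5, Fürstenberg–Kifer: the exponent through stationary measures)] -/
theorem IsStationaryFor.andersonLyapunov_le_integral_circlePsi {μ : Measure ℝ} [IsProbabilityMeasure μ]
    (hc : IsCompact μ.support) (hnt : μ.support.Nontrivial) {E : ℝ} (hE : E ∈ Icc (-andersonKappa μ) (andersonKappa μ))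
    {ν : Measure 𝕊} [IsProbabilityMeasure ν] (h : IsStationaryFor μ E ν) :
    andersonLyapunov μ E ≤ ∫ v, circlePsi μ E v ∂ν := by
  set lg := Real.log Γ[μ] with hlg
  have hlg0 : 0 < lg := log_gam_pos μ
  have hna : ∀ p, ν {p} = 0 := h.measure_singleton_eq_zero hnt
  refine le_of_forall_pos_le_add fun ε hε => ?_
  -- choose δ with 2 δ log Γ ≤ ε/2 and the band radius r ≤ 1
  set δ : ℝ := ε / (4 * lg) with hδdef
  have hδ0 : 0 < δ := by positivity
  obtain ⟨r₀, hr₀, hband₀⟩ := exists_radius_measure_band_le ν hna (ENNReal.ofReal_pos.mpr hδ0)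
  set r : ℝ := min r₀ 1 with hrdef
  have hr0 : 0 < r := lt_min hr₀ one_pos
  have hr1 : r ≤ 1 := min_le_right _ _
  have hband : ∀ u : 𝕊, ν {v : 𝕊 | |(u : EuclideanSpace ℝ (Fin 2)) 0 * (v : EuclideanSpace ℝ (Fin 2)) 0 +
      (u : EuclideanSpace ℝ (Fin 2)) 1 * (v : EuclideanSpace ℝ (Fin 2)) 1| < r} ≤ ENNReal.ofReal δ := by
    intro u
    refine le_trans (measure_mono fun v hv => ?_) (hband₀ u)
    simp only [Set.mem_setOf_eq] at hv ⊢
    exact lt_of_lt_of_le hv (min_le_left _ _)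
  -- choose m with (log √2 - log r)/m ≤ ε/2
  obtain ⟨m, hm⟩ := exists_nat_gt ((Real.log (Real.sqrt 2) - Real.log r) / (ε / 2))
  have hm1 : 1 ≤ m + 1 := Nat.le_add_left 1 m
  have hmpos : (0 : ℝ) < (m + 1 : ℕ) := by positivity
  have key := integral_integral_log_norm_apply_ge_of_bands hc hE hm1 ν hr0 hr1 hδ0.le hband
  -- Fubini and stationarity: the double integral is (m+1) ∫ ψ dν
  have hswap : ∫ x, (∫ v, Real.log ‖Matrix.toEuclideanLin (andersonTransferProd E (padSeq x) (m + 1)) v‖ ∂ν)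
      ∂(Measure.pi fun _ : Fin (m + 1) => μ) =
      ∫ v, (∫ x, Real.log ‖Matrix.toEuclideanLin (andersonTransferProd E (padSeq x) (m + 1)) v‖
        ∂(Measure.pi fun _ : Fin (m + 1) => μ)) ∂ν := by
    refine integral_integral_swap ?_
    refine Integrable.of_bound (continuous_log_norm_transferProd_apply_uncurry E (m + 1)).measurable.aestronglyMeasurable
      ((m + 1 : ℕ) * lg) ?_
    have hbox := ae_pi_abs_le_kappa_sub_two (μ := μ) hc (m + 1)
    have hbox' := (Measure.quasiMeasurePreserving_fst (μ := Measure.pi fun _ : Fin (m + 1) => μ) (ν := ν)).ae hbox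
    filter_upwards [hbox'] with p hp
    rw [Real.norm_eq_abs]
    exact abs_log_norm_apply_le_of_box hE hp (norm_coe_circle p.2) (m + 1) le_rfl
  rw [hswap, h.integral_integral_log_norm_apply_eq hc hE (m + 1)] at key
  -- bookkeeping
  have hlogdiff : Real.log (Real.sqrt 2) - Real.log r ≤ (m + 1 : ℕ) * (ε / 2) := by
    have h1 : (Real.log (Real.sqrt 2) - Real.log r) / (ε / 2) < m := hm
    rw [div_lt_iff₀ (by positivity)] at h1
    push_cast
    nlinarith
  have hδterm : 2 * δ * (m + 1 : ℕ) * lg = (m + 1 : ℕ) * (ε / 2) := by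
    rw [hδdef]; field_simp; ring
  rw [hδterm] at key
  -- divide by m+1
  have : (m + 1 : ℕ) * andersonLyapunov μ E ≤ (m + 1 : ℕ) * (∫ v, circlePsi μ E v ∂ν + ε) := by nlinarith
  exact le_of_mul_le_mul_left this hmpos

/-- **Fürstenberg's formula for the Anderson model**: `∫ ψ_E dν = L(E)` for every `μ`-stationary
probability measure `ν` on the circle (single-site law with compact support of at least two points,
`E ∈ Σ̂`). [cite: BucajEtAl2019, Thm 2.5 (Fürstenberg–Kifer) and Thm 2.3] -/
theorem IsStationaryFor.integral_circlePsi_eq_andersonLyapunov {μ : Measure ℝ} [IsProbabilityMeasure μ]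
    (hc : IsCompact μ.support) (hnt : μ.support.Nontrivial) {E : ℝ} (hE : E ∈ Icc (-andersonKappa μ) (andersonKappa μ))
    {ν : Measure 𝕊} [IsProbabilityMeasure ν] (h : IsStationaryFor μ E ν) :
    ∫ v, circlePsi μ E v ∂ν = andersonLyapunov μ E :=
  le_antisymm (h.integral_circlePsi_le_andersonLyapunov hc hE) (h.andersonLyapunov_le_integral_circlePsi hc hnt hE)

end Literature.Probability.RandomMatrixProducts

end



/-! ## Part F: compactness — limit points of (almost) stationary measures, existence of stationary
measures, uniform one-scale bounds, and the discharge of `BucajEtAl2019_vectorLDT` -/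

noncomputable section

open MeasureTheory Set Filter Topology BoundedContinuousFunction
open scoped Matrix.Norms.L2Operator ENNReal Matrix

namespace Literature.Probability.RandomMatrixProducts

local notation "𝕊" => Metric.sphere (0 : EuclideanSpace ℝ (Fin 2)) 1

local notation "Γ[" μ "]" => (2 * andersonKappa μ - 1 : ℝ)

/-! ### Weak convergence on the circle -/

/-- Weak convergence of probability measures on the circle tested on a continuous function. [folklore] -/
theorem tendsto_integral_of_tendsto_probabilityMeasure {νs : ℕ → ProbabilityMeasure 𝕊} {ν : ProbabilityMeasure 𝕊}
    (hν : Tendsto νs atTop (𝓝 ν)) {f : 𝕊 → ℝ} (hf : Continuous f) :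
    Tendsto (fun j => ∫ v, f v ∂(νs j : Measure 𝕊)) atTop (𝓝 (∫ v, f v ∂(ν : Measure 𝕊))) := by
  have h := (ProbabilityMeasure.tendsto_iff_forall_integral_tendsto.mp hν) (mkOfCompact ⟨f, hf⟩)
  exact h

/-- **The Markov operator depends continuously on the energy, uniformly on the circle**: for `f`
continuous, `sup_v |Q_{E'} f(v) - Q_E f(v)| → 0` as `E' → E` (uniform continuity of
`(E, a, v) ↦ f(M^E(a) · v)` on a compact set). [folklore] -/
theorem exists_delta_circleMarkov_sub_le {μ : Measure ℝ} [IsProbabilityMeasure μ] (hc : IsCompact μ.support) (E : ℝ)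
    {f : 𝕊 → ℝ} (hf : Continuous f) {η : ℝ} (hη : 0 < η) :
    ∃ θ : ℝ, 0 < θ ∧ ∀ E' : ℝ, |E' - E| < θ → ∀ v : 𝕊, |circleMarkov μ E' f v - circleMarkov μ E f v| ≤ η := by
  set R : ℝ := andersonKappa μ - 2 with hRdef
  set K : Set (ℝ × ℝ × 𝕊) := Icc (E - 1) (E + 1) ×ˢ (Icc (-R) R ×ˢ univ) with hK
  have hKc : IsCompact K := isCompact_Icc.prod (isCompact_Icc.prod isCompact_univ)
  set F : ℝ × ℝ × 𝕊 → ℝ := fun p => f (projAct (andersonTransfer p.1 p.2.1) p.2.2) with hF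
  have hFc : Continuous F := hf.comp continuous_projAct_andersonTransfer
  have hUC := hKc.uniformContinuousOn_of_continuous hFc.continuousOn
  rw [Metric.uniformContinuousOn_iff] at hUC
  obtain ⟨θ, hθ, hθF⟩ := hUC η hη
  refine ⟨min θ 1, lt_min hθ one_pos, fun E' hE' v => ?_⟩
  have hE'θ : |E' - E| < θ := lt_of_lt_of_le hE' (min_le_left _ _)
  have hE'1 : |E' - E| < 1 := lt_of_lt_of_le hE' (min_le_right _ _)
  -- pointwise closeness for a in the support box
  have hpt : ∀ a : ℝ, |a| ≤ R → |f (projAct (andersonTransfer E' a) v) - f (projAct (andersonTransfer E a) v)| < η := by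
    intro a ha
    have hp : ((E', a, v) : ℝ × ℝ × 𝕊) ∈ K := by
      rw [hK]
      refine ⟨⟨by linarith [(abs_lt.mp hE'1).1], by linarith [(abs_lt.mp hE'1).2]⟩, ⟨abs_le.mp ha, mem_univ _⟩⟩
    have hq : ((E, a, v) : ℝ × ℝ × 𝕊) ∈ K := by
      rw [hK]
      refine ⟨⟨by linarith, by linarith⟩, ⟨abs_le.mp ha, mem_univ _⟩⟩
    have hdist : dist ((E', a, v) : ℝ × ℝ × 𝕊) ((E, a, v) : ℝ × ℝ × 𝕊) < θ := by
      rw [Prod.dist_eq, Prod.dist_eq, dist_self, dist_self, max_self, max_eq_left dist_nonneg, Real.dist_eq]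
      exact hE'θ
    have := hθF _ hp _ hq hdist
    rwa [Real.dist_eq] at this
  -- integrate
  unfold circleMarkov
  have hi : ∀ E₀ : ℝ, Integrable (fun a => f (projAct (andersonTransfer E₀ a) v)) μ := by
    intro E₀
    obtain ⟨C, hC⟩ := (isCompact_univ.image hf).isBounded.subset_closedBall 0
    refine Integrable.of_bound (hf.comp (continuous_projAct_andersonTransfer_left E₀ v)).measurable.aestronglyMeasurable C
      (Eventually.of_forall fun a => ?_)
    have := hC (mem_image_of_mem f (mem_univ (projAct (andersonTransfer E₀ a) v)))
    rwa [Metric.mem_closedBall, dist_zero_right] at this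
  rw [← integral_sub (hi E') (hi E)]
  refine abs_integral_le_integral_abs.trans ?_
  have h2 : ∫ a, |f (projAct (andersonTransfer E' a) v) - f (projAct (andersonTransfer E a) v)| ∂μ ≤ ∫ _a, η ∂μ := by
    refine integral_mono_ae ((hi E').sub (hi E)).abs (integrable_const _) ?_
    filter_upwards [ae_abs_le_andersonKappa_sub_two μ hc] with a ha
    exact (hpt a ha).le
  refine h2.trans ?_
  rw [integral_const, probReal_univ, one_smul]

/-- **Limits of almost stationary measures are stationary** (with varying energies): if `ν_j → ν`
weakly, `E_j → E`, and `∫ Q_{E_j} f dν_j - ∫ f dν_j → 0` for every continuous `f`, then `ν` is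
`μ`-stationary at energy `E`. [cite: BucajEtAl2019, Thm 2.6 (proof: weak limits of `ν_{E_n}`)] -/
theorem isStationaryFor_of_tendsto {μ : Measure ℝ} [IsProbabilityMeasure μ] (hc : IsCompact μ.support)
    {Es : ℕ → ℝ} {E : ℝ} (hE : Tendsto Es atTop (𝓝 E))
    {νs : ℕ → ProbabilityMeasure 𝕊} {ν : ProbabilityMeasure 𝕊} (hν : Tendsto νs atTop (𝓝 ν))
    (happrox : ∀ f : 𝕊 → ℝ, Continuous f → ∀ C : ℝ, (∀ v, |f v| ≤ C) →
      Tendsto (fun j => ∫ v, circleMarkov μ (Es j) f v ∂(νs j : Measure 𝕊) - ∫ v, f v ∂(νs j : Measure 𝕊)) atTop (𝓝 0)) :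
    IsStationaryFor μ E (ν : Measure 𝕊) := by
  -- Step 1: ∫ Q_E f dν = ∫ f dν for continuous f
  have hfun : ∀ f : 𝕊 → ℝ, Continuous f → ∫ v, circleMarkov μ E f v ∂(ν : Measure 𝕊) = ∫ v, f v ∂(ν : Measure 𝕊) := by
    intro f hf
    obtain ⟨C, hC⟩ : ∃ C, ∀ v, |f v| ≤ C := by
      obtain ⟨C, hC⟩ := (isCompact_univ.image hf).isBounded.subset_closedBall 0
      refine ⟨C, fun v => ?_⟩
      have := hC (mem_image_of_mem f (mem_univ v))
      rwa [Metric.mem_closedBall, dist_zero_right, Real.norm_eq_abs] at this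
    have hQc : Continuous (circleMarkov μ E f) := continuous_circleMarkov μ E hf hC
    have h1 : Tendsto (fun j => ∫ v, f v ∂(νs j : Measure 𝕊)) atTop (𝓝 (∫ v, f v ∂(ν : Measure 𝕊))) :=
      tendsto_integral_of_tendsto_probabilityMeasure hν hf
    have h2 : Tendsto (fun j => ∫ v, circleMarkov μ E f v ∂(νs j : Measure 𝕊)) atTop
        (𝓝 (∫ v, circleMarkov μ E f v ∂(ν : Measure 𝕊))) :=
      tendsto_integral_of_tendsto_probabilityMeasure hν hQc
    -- the energy correction tends to zero uniformly
    have h3 : Tendsto (fun j => ∫ v, circleMarkov μ (Es j) f v ∂(νs j : Measure 𝕊) -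
        ∫ v, circleMarkov μ E f v ∂(νs j : Measure 𝕊)) atTop (𝓝 0) := by
      rw [Metric.tendsto_nhds]
      intro η hη
      obtain ⟨θ, hθ, hθQ⟩ := exists_delta_circleMarkov_sub_le hc E hf (half_pos hη)
      have hev : ∀ᶠ j in atTop, |Es j - E| < θ := by
        have := (Metric.tendsto_nhds.mp hE) θ hθ
        filter_upwards [this] with j hj
        rwa [Real.dist_eq] at hj
      filter_upwards [hev] with j hj
      rw [Real.dist_eq, sub_zero]
      have hiQ : ∀ E₀, Integrable (circleMarkov μ E₀ f) (νs j : Measure 𝕊) := fun E₀ =>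
        Integrable.of_bound (measurable_circleMarkov μ E₀ hf.measurable).aestronglyMeasurable C
          (Eventually.of_forall fun v => by rw [Real.norm_eq_abs]; exact abs_circleMarkov_le μ E₀ hC v)
      rw [← integral_sub (hiQ (Es j)) (hiQ E)]
      refine lt_of_le_of_lt (abs_integral_le_integral_abs.trans ?_) (half_lt_self hη)
      have hm : ∫ v, |circleMarkov μ (Es j) f v - circleMarkov μ E f v| ∂(νs j : Measure 𝕊) ≤ ∫ _v, η / 2 ∂(νs j : Measure 𝕊) :=
        integral_mono_of_nonneg (Eventually.of_forall fun v => abs_nonneg _) (integrable_const _)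
          (Eventually.of_forall fun v => hθQ (Es j) hj v)
      refine hm.trans ?_
      rw [integral_const, probReal_univ, one_smul]
    -- assemble: s_j → 0 and s_j → ∫ Q_E f dν - ∫ f dν
    have h4 : Tendsto (fun j => ∫ v, circleMarkov μ (Es j) f v ∂(νs j : Measure 𝕊) - ∫ v, f v ∂(νs j : Measure 𝕊)) atTop
        (𝓝 (∫ v, circleMarkov μ E f v ∂(ν : Measure 𝕊) - ∫ v, f v ∂(ν : Measure 𝕊))) := by
      have := (h3.add h2).sub h1
      simp only [zero_add] at this
      refine this.congr fun j => ?_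
      ring
    have := tendsto_nhds_unique h4 (happrox f hf C hC)
    linarith
  -- Step 2: the measure equation from the functional one
  unfold IsStationaryFor
  have hmeas := measurable_projAct_andersonTransfer E
  haveI : IsProbabilityMeasure ((μ.prod (ν : Measure 𝕊)).map fun p : ℝ × 𝕊 => projAct (andersonTransfer E p.1) p.2) :=
    Measure.isProbabilityMeasure_map hmeas.aemeasurable
  refine ext_of_forall_integral_eq_of_IsFiniteMeasure fun g => ?_
  have hgi : Integrable (fun p : ℝ × 𝕊 => g (projAct (andersonTransfer E p.1) p.2)) (μ.prod (ν : Measure 𝕊)) := by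
    refine Integrable.of_bound ((g.continuous.measurable.comp hmeas).aestronglyMeasurable) ‖g‖ (Eventually.of_forall fun p => ?_)
    exact g.norm_coe_le_norm _
  rw [integral_map hmeas.aemeasurable g.continuous.aestronglyMeasurable, integral_prod_symm _ hgi]
  exact hfun g g.continuous

/-- **Existence of stationary measures** (Krylov–Bogolyubov on the compact circle): for every energy there
is a `μ`-stationary probability measure. [cite: BucajEtAl2019, §2 (the measure `ν_E` on `ℝℙ¹`)] -/
theorem exists_isStationaryFor {μ : Measure ℝ} [IsProbabilityMeasure μ] (hc : IsCompact μ.support) (E : ℝ) :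
    ∃ ν : ProbabilityMeasure 𝕊, IsStationaryFor μ E (ν : Measure 𝕊) := by
  let w₀ : 𝕊 := ⟨EuclideanSpace.single 0 1, by simp⟩
  set P : ℕ → ProbabilityMeasure 𝕊 := fun n => ⟨cesaroLaw μ E n w₀, inferInstance⟩ with hP
  obtain ⟨ν, -, φ, hφ, hlim⟩ := isCompact_univ.tendsto_subseq (x := P) fun n => mem_univ _
  refine ⟨ν, isStationaryFor_of_tendsto hc tendsto_const_nhds hlim fun f hf C hC => ?_⟩
  have hbound : ∀ k, ‖∫ v, circleMarkov μ E f v ∂(P (φ k) : Measure 𝕊) - ∫ v, f v ∂(P (φ k) : Measure 𝕊)‖ ≤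
      2 * C / ((φ k : ℝ) + 1) := by
    intro k
    rw [Real.norm_eq_abs]
    exact abs_integral_circleMarkov_cesaroLaw_sub_le μ E (φ k) w₀ hf.measurable hC
  refine squeeze_zero_norm hbound ?_
  have h1 : Tendsto (fun k => ((φ k : ℝ) + 1)) atTop atTop :=
    tendsto_atTop_add_const_right _ 1 (tendsto_natCast_atTop_atTop.comp hφ.tendsto_atTop)
  exact tendsto_const_nhds.div_atTop h1

/-! ### Continuity in the energy and sub-additivity of the matrix averages -/

/-- `E ↦ n⁻¹ 𝔼 log ‖M_n^E‖` is continuous (from `AndersonModel1DContinuityBasics`). [folklore] -/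
theorem continuous_andersonLogNormAvg_of_isCompact {μ : Measure ℝ} [IsProbabilityMeasure μ] (hc : IsCompact μ.support)
    (n : ℕ) : Continuous fun E : ℝ => andersonLogNormAvg μ E n :=
  continuous_andersonLogNormAvg μ (by linarith [two_le_andersonKappa μ]) (ae_abs_le_andersonKappa_sub_two μ hc) n

/-- **Sub-additivity consequence**: `n⁻¹ 𝔼 log ‖M_n‖ ≤ M⁻¹ 𝔼 log ‖M_M‖ + M log Γ / n` for `1 ≤ M ≤ n`
(`a_{qM+r} ≤ q a_M + a_r`, `a_r ≤ r log Γ`). [cite: BucajEtAl2019, §2 (`L = inf_n = lim_n`, Fekete)] -/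
theorem andersonLogNormAvg_le_add_div {μ : Measure ℝ} [IsProbabilityMeasure μ] (hc : IsCompact μ.support)
    {E : ℝ} (hE : E ∈ Icc (-andersonKappa μ) (andersonKappa μ)) {M n : ℕ} (hM : 1 ≤ M) (hMn : M ≤ n) :
    andersonLogNormAvg μ E n ≤ andersonLogNormAvg μ E M + M * Real.log Γ[μ] / n := by
  set lg := Real.log Γ[μ] with hlg
  have hlg0 : 0 ≤ lg := (log_gam_pos μ).le
  set a : ℕ → ℝ := fun k => ∫ x, Real.log ‖andersonTransferProd E (padSeq x) k‖ ∂(Measure.pi fun _ : Fin k => μ) with ha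
  have hR0 : (0 : ℝ) ≤ andersonKappa μ - 2 := by linarith [two_le_andersonKappa μ]
  have hsub : ∀ p q, a (p + q) ≤ a p + a q := fun p q =>
    integral_log_norm_transferProd_add_le μ hR0 (ae_abs_le_andersonKappa_sub_two μ hc) E p q
  have havg : ∀ k, a k = k * andersonLogNormAvg μ E k := by
    intro k
    rcases Nat.eq_zero_or_pos k with rfl | hk
    · simp [ha, andersonLogNormAvg]
    · have hk' : (0 : ℝ) < k := by exact_mod_cast hk
      simp only [ha]
      unfold andersonLogNormAvg; field_simp
  have ha0 : ∀ k, 0 ≤ a k := fun k => by rw [havg]; exact mul_nonneg (Nat.cast_nonneg _) (andersonLogNormAvg_nonneg μ E k)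
  have hale : ∀ k, a k ≤ k * lg := fun k => by
    rw [havg]; exact mul_le_mul_of_nonneg_left (andersonLogNormAvg_le_log μ hc hE k) (Nat.cast_nonneg _)
  -- a (q M + r) ≤ q a M + a r
  have hq : ∀ q r : ℕ, a (q * M + r) ≤ q * a M + a r := by
    intro q r
    induction q with
    | zero => simp
    | succ q ih =>
      calc a ((q + 1) * M + r) = a ((q * M + r) + M) := by congr 1; ring
        _ ≤ a (q * M + r) + a M := hsub _ _
        _ ≤ (q * a M + a r) + a M := by linarith
        _ = ((q + 1 : ℕ) : ℝ) * a M + a r := by push_cast; ring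
  obtain ⟨q, r, hr, hn⟩ : ∃ q r : ℕ, r < M ∧ n = q * M + r := ⟨n / M, n % M, Nat.mod_lt n hM, by rw [Nat.div_add_mod']⟩
  have hn0 : (0 : ℝ) < n := by exact_mod_cast lt_of_lt_of_le hM hMn
  have hM0 : (0 : ℝ) < M := by exact_mod_cast hM
  have h1 : a n ≤ q * a M + r * lg := by
    rw [hn]; exact (hq q r).trans (by linarith [hale r])
  have hqM : (q : ℝ) * M ≤ n := by
    have : q * M ≤ n := by rw [hn]; exact Nat.le_add_right _ _
    exact_mod_cast this
  have hrM : (r : ℝ) ≤ M := by exact_mod_cast hr.le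
  -- divide by n
  have key : a n / n ≤ a M / M + M * lg / n := by
    rw [div_add_div _ _ hM0.ne' hn0.ne', div_le_div_iff₀ hn0 (mul_pos hM0 hn0)]
    have haM := ha0 M
    have hA : a n * (M * n) ≤ (q * a M + r * lg) * (M * n) := mul_le_mul_of_nonneg_right h1 (by positivity)
    have hB : (q : ℝ) * M * (a M * n) ≤ n * (a M * n) := mul_le_mul_of_nonneg_right hqM (by positivity)
    have hC : (r : ℝ) * (M * lg * n) ≤ M * (M * lg * n) := mul_le_mul_of_nonneg_right hrM (by positivity)
    nlinarith [hA, hB, hC]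
  have e1 : andersonLogNormAvg μ E n = a n / n := by rw [havg]; field_simp
  have e2 : andersonLogNormAvg μ E M = a M / M := by rw [havg]; field_simp
  rw [e1, e2]
  exact key

/-! ### The uniform one-scale bounds -/

/-- The Cesàro measures as probability measures. [folklore] -/
def cesaroPM (μ : Measure ℝ) [IsProbabilityMeasure μ] (E : ℝ) (n : ℕ) (w : 𝕊) : ProbabilityMeasure 𝕊 :=
  ⟨cesaroLaw μ E n w, inferInstance⟩

/-- Coercion of `cesaroPM`. [folklore] -/
theorem coe_cesaroPM (μ : Measure ℝ) [IsProbabilityMeasure μ] (E : ℝ) (n : ℕ) (w : 𝕊) :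
    ((cesaroPM μ E n w : ProbabilityMeasure 𝕊) : Measure 𝕊) = cesaroLaw μ E n w := rfl

/-- Integrals of `ψ_E` against measures on the circle move by at most `Γ |E - E'|` with the energy.
[cite: BucajEtAl2019, Lemma 3.3 (display (3.7))] -/
theorem abs_integral_circlePsi_sub_le {μ : Measure ℝ} [IsProbabilityMeasure μ] (hc : IsCompact μ.support)
    {E E' : ℝ} (hE : E ∈ Icc (-andersonKappa μ) (andersonKappa μ)) (hE' : E' ∈ Icc (-andersonKappa μ) (andersonKappa μ))
    (ρ : Measure 𝕊) [IsProbabilityMeasure ρ] :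
    |∫ v, circlePsi μ E v ∂ρ - ∫ v, circlePsi μ E' v ∂ρ| ≤ Γ[μ] * |E - E'| := by
  have hi : ∀ E₀ ∈ Icc (-andersonKappa μ) (andersonKappa μ), Integrable (circlePsi μ E₀) ρ := fun E₀ hE₀ =>
    Integrable.of_bound (measurable_circlePsi hc E₀).aestronglyMeasurable (Real.log Γ[μ])
      (Eventually.of_forall fun v => by rw [Real.norm_eq_abs]; exact abs_circlePsi_le hc hE₀ v)
  rw [← integral_sub (hi E hE) (hi E' hE')]
  refine abs_integral_le_integral_abs.trans ?_
  have h : ∫ v, |circlePsi μ E v - circlePsi μ E' v| ∂ρ ≤ ∫ _v, Γ[μ] * |E - E'| ∂ρ :=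
    integral_mono_of_nonneg (Eventually.of_forall fun v => abs_nonneg _) (integrable_const _)
      (Eventually.of_forall fun v => abs_circlePsi_sub_circlePsi_le hc hE hE' v)
  refine h.trans ?_
  rw [integral_const, probReal_univ, one_smul]

/-- **Convergence of `∫ ψ_{E_j} dρ_j`**: if `E_j → E` in `Σ̂` and `ρ_j → ρ` weakly then
`∫ ψ_{E_j} dρ_j → ∫ ψ_E dρ`. [folklore] -/
theorem tendsto_integral_circlePsi {μ : Measure ℝ} [IsProbabilityMeasure μ] (hc : IsCompact μ.support)
    {Es : ℕ → ℝ} (hEs : ∀ j, Es j ∈ Icc (-andersonKappa μ) (andersonKappa μ)) {E : ℝ}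
    (hE : E ∈ Icc (-andersonKappa μ) (andersonKappa μ)) (hlimE : Tendsto Es atTop (𝓝 E))
    {ρs : ℕ → ProbabilityMeasure 𝕊} {ρ : ProbabilityMeasure 𝕊} (hlim : Tendsto ρs atTop (𝓝 ρ)) :
    Tendsto (fun j => ∫ v, circlePsi μ (Es j) v ∂(ρs j : Measure 𝕊)) atTop (𝓝 (∫ v, circlePsi μ E v ∂(ρ : Measure 𝕊))) := by
  have h1 : Tendsto (fun j => ∫ v, circlePsi μ E v ∂(ρs j : Measure 𝕊)) atTop (𝓝 (∫ v, circlePsi μ E v ∂(ρ : Measure 𝕊))) :=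
    tendsto_integral_of_tendsto_probabilityMeasure hlim (continuous_circlePsi hc E)
  refine h1.congr_dist ?_
  have hbound : ∀ j, dist (∫ v, circlePsi μ E v ∂(ρs j : Measure 𝕊)) (∫ v, circlePsi μ (Es j) v ∂(ρs j : Measure 𝕊)) ≤
      Γ[μ] * |E - Es j| := fun j => by
    rw [Real.dist_eq]; exact abs_integral_circlePsi_sub_le hc hE (hEs j) _
  refine squeeze_zero (fun j => dist_nonneg) hbound ?_
  have : Tendsto (fun j => Γ[μ] * |E - Es j|) atTop (𝓝 (Γ[μ] * |E - E|)) :=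
    ((tendsto_const_nhds.sub hlimE).abs).const_mul _
  simpa using this

/-- **The uniform lower bound at one scale** (the role of Props. 3.2/3.4 of the source): for every
`ε > 0` there is `N₀` with `𝔼 log ‖M_n^E w‖ ≥ n (L(E) - ε)` for all `n ≥ N₀`, all `E ∈ Σ̂` and all unit
`w`. Proof by contradiction: Cesàro measures along a bad sequence converge (compactness of `Σ̂` and of
the probability measures on the circle) to a stationary measure, whose `ψ`-integral is `L` by
Fürstenberg's formula, while the bad inequality and the upper semicontinuity of `L` force it below `L - ε`.
[cite: BucajEtAl2019, Prop. 3.2 and Prop. 3.4] -/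
theorem exists_uniform_lower_logMoment {μ : Measure ℝ} [IsProbabilityMeasure μ] (hc : IsCompact μ.support)
    (hnt : μ.support.Nontrivial) {ε : ℝ} (hε : 0 < ε) :
    ∃ N₀ : ℕ, ∀ n : ℕ, N₀ ≤ n → ∀ E ∈ Icc (-andersonKappa μ) (andersonKappa μ), ∀ w : 𝕊,
      (n : ℝ) * (andersonLyapunov μ E - ε) ≤
        ∫ x, Real.log ‖Matrix.toEuclideanLin (andersonTransferProd E (padSeq x) n) w‖ ∂(Measure.pi fun _ : Fin n => μ) := by
  by_contra hcon
  have H : ∀ j : ℕ, ∃ m : ℕ, j ≤ m ∧ ∃ E : ℝ, E ∈ Icc (-andersonKappa μ) (andersonKappa μ) ∧ ∃ w : 𝕊,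
      ∫ x, Real.log ‖Matrix.toEuclideanLin (andersonTransferProd E (padSeq x) (m + 1)) w‖ ∂(Measure.pi fun _ : Fin (m + 1) => μ) <
        ((m : ℝ) + 1) * (andersonLyapunov μ E - ε) := by
    intro j
    simp only [not_exists, not_forall, not_le, exists_prop] at hcon
    obtain ⟨n, hn, E, hE, w, hw⟩ := hcon (j + 1)
    obtain ⟨m, rfl⟩ : ∃ m, n = m + 1 := ⟨n - 1, by omega⟩
    refine ⟨m, by omega, E, hE, w, ?_⟩
    push_cast at hw
    exact hw
  choose m hm E hE w hw using H
  -- extract converging subsequences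
  obtain ⟨Es, hEs, φ₁, hφ₁, hlimE⟩ := isCompact_Icc.tendsto_subseq (x := E) hE
  obtain ⟨ν, -, φ₂, hφ₂, hlimν⟩ := isCompact_univ.tendsto_subseq
    (x := fun k => cesaroPM μ (E (φ₁ k)) (m (φ₁ k)) (w (φ₁ k))) fun k => mem_univ _
  set ψ : ℕ → ℕ := φ₁ ∘ φ₂ with hψ
  have hψm : StrictMono ψ := hφ₁.comp hφ₂
  have hlimE' : Tendsto (E ∘ ψ) atTop (𝓝 Es) := hlimE.comp hφ₂.tendsto_atTop
  have hlimν' : Tendsto (fun k => cesaroPM μ (E (ψ k)) (m (ψ k)) (w (ψ k))) atTop (𝓝 ν) := hlimν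
  have hmge : ∀ k, k ≤ m (ψ k) := fun k => (hψm.id_le k).trans (hm (ψ k))
  have hm1 : Tendsto (fun k => ((m (ψ k) : ℝ) + 1)) atTop atTop :=
    tendsto_atTop_add_const_right _ 1 (tendsto_natCast_atTop_atTop.comp (tendsto_atTop_mono hmge tendsto_id))
  -- the limit is stationary at Es
  have hstat : IsStationaryFor μ Es (ν : Measure 𝕊) := by
    refine isStationaryFor_of_tendsto hc hlimE' hlimν' fun f hf C hC => ?_
    have hbound : ∀ k, ‖∫ v, circleMarkov μ ((E ∘ ψ) k) f v ∂(cesaroPM μ (E (ψ k)) (m (ψ k)) (w (ψ k)) : Measure 𝕊) -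
        ∫ v, f v ∂(cesaroPM μ (E (ψ k)) (m (ψ k)) (w (ψ k)) : Measure 𝕊)‖ ≤ 2 * C / ((m (ψ k) : ℝ) + 1) := by
      intro k
      rw [Real.norm_eq_abs, coe_cesaroPM]
      exact abs_integral_circleMarkov_cesaroLaw_sub_le μ (E (ψ k)) (m (ψ k)) (w (ψ k)) hf.measurable hC
    exact squeeze_zero_norm hbound (tendsto_const_nhds.div_atTop hm1)
  -- Fürstenberg's formula at Es, and convergence of the Cesàro integrals of ψ
  have hKL := hstat.integral_circlePsi_eq_andersonLyapunov hc hnt hEs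
  have hconv := tendsto_integral_circlePsi hc (fun k => hE (ψ k)) hEs hlimE' hlimν'
  -- each Cesàro integral is below L_{M}(E_k) - ε
  have hup : ∀ (M : ℕ) (k : ℕ), ∫ v, circlePsi μ (E (ψ k)) v ∂(cesaroPM μ (E (ψ k)) (m (ψ k)) (w (ψ k)) : Measure 𝕊) ≤
      andersonLogNormAvg μ (E (ψ k)) (M + 1) - ε := by
    intro M k
    rw [coe_cesaroPM, integral_circlePsi_cesaroLaw hc (hE (ψ k))]
    have h1 := hw (ψ k)
    have h2 := andersonLyapunov_le_logNormAvg μ (E (ψ k)) (Nat.succ_pos M)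
    have hpos : (0 : ℝ) < (m (ψ k) : ℝ) + 1 := by positivity
    rw [inv_mul_le_iff₀ hpos]
    nlinarith
  -- pass to the limit
  have hle : ∀ M : ℕ, ∫ v, circlePsi μ Es v ∂(ν : Measure 𝕊) ≤ andersonLogNormAvg μ Es (M + 1) - ε := by
    intro M
    have hcont : Tendsto (fun k => andersonLogNormAvg μ (E (ψ k)) (M + 1) - ε) atTop (𝓝 (andersonLogNormAvg μ Es (M + 1) - ε)) :=
      (((continuous_andersonLogNormAvg_of_isCompact hc (M + 1)).tendsto Es).comp hlimE').sub_const ε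
    exact le_of_tendsto_of_tendsto' hconv hcont (hup M)
  have : andersonLyapunov μ Es + ε ≤ andersonLyapunov μ Es :=
    calc andersonLyapunov μ Es + ε = ∫ v, circlePsi μ Es v ∂(ν : Measure 𝕊) + ε := by rw [hKL]
      _ ≤ ⨅ M : ℕ, andersonLogNormAvg μ Es (M + 1) := le_ciInf fun M => by linarith [hle M]
      _ = andersonLyapunov μ Es := rfl
  linarith

/-- **The uniform upper bound at one scale** (uniform convergence of `n⁻¹ 𝔼 log ‖M_n^E‖` to `L(E)` on
`Σ̂`, i.e. the continuity of `L`, Thm 2.6 of the source, in the form needed): for every `ε > 0` there is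
`N₀` with `n⁻¹ 𝔼 log ‖M_n^E‖ ≤ L(E) + ε` for all `n ≥ N₀` and all `E ∈ Σ̂`. Proof by contradiction with
stationary measures `ν_{E_j}` of a bad sequence: a weak limit is stationary at the limit energy, so
`L(E_j) = ∫ ψ_{E_j} dν_j → L(E*)`, while sub-additivity bounds `n_j⁻¹ 𝔼 log ‖M_{n_j}^{E_j}‖` by
`L_M(E_j) + o(1) → L_M(E*)` for every `M`. [cite: BucajEtAl2019, Thm 2.6 and Prop. 3.4] -/
theorem exists_uniform_upper_logNormAvg {μ : Measure ℝ} [IsProbabilityMeasure μ] (hc : IsCompact μ.support)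
    (hnt : μ.support.Nontrivial) {ε : ℝ} (hε : 0 < ε) :
    ∃ N₀ : ℕ, ∀ n : ℕ, N₀ ≤ n → ∀ E ∈ Icc (-andersonKappa μ) (andersonKappa μ),
      andersonLogNormAvg μ E n ≤ andersonLyapunov μ E + ε := by
  by_contra hcon
  have H : ∀ j : ℕ, ∃ n : ℕ, j + 1 ≤ n ∧ ∃ E : ℝ, E ∈ Icc (-andersonKappa μ) (andersonKappa μ) ∧
      andersonLyapunov μ E + ε < andersonLogNormAvg μ E n := by
    intro j
    simp only [not_exists, not_forall, not_le, exists_prop] at hcon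
    obtain ⟨n, hn, E, hE, hlt⟩ := hcon (j + 1)
    exact ⟨n, hn, E, hE, hlt⟩
  choose n hn E hE hlt using H
  -- stationary measures at the bad energies
  have hstatE : ∀ j, ∃ ν : ProbabilityMeasure 𝕊, IsStationaryFor μ (E j) (ν : Measure 𝕊) := fun j =>
    exists_isStationaryFor hc (E j)
  choose νs hνs using hstatE
  -- subsequences
  obtain ⟨Es, hEs, φ₁, hφ₁, hlimE⟩ := isCompact_Icc.tendsto_subseq (x := E) hE
  obtain ⟨ν, -, φ₂, hφ₂, hlimν⟩ := isCompact_univ.tendsto_subseq (x := νs ∘ φ₁) fun k => mem_univ _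
  set ψ : ℕ → ℕ := φ₁ ∘ φ₂ with hψ
  have hψm : StrictMono ψ := hφ₁.comp hφ₂
  have hlimE' : Tendsto (E ∘ ψ) atTop (𝓝 Es) := hlimE.comp hφ₂.tendsto_atTop
  have hlimν' : Tendsto (νs ∘ ψ) atTop (𝓝 ν) := hlimν
  have hnge : ∀ k, k + 1 ≤ n (ψ k) := fun k => (Nat.succ_le_succ (hψm.id_le k)).trans (hn (ψ k))
  have hn_atTop : Tendsto (fun k => (n (ψ k) : ℝ)) atTop atTop :=
    tendsto_natCast_atTop_atTop.comp (tendsto_atTop_mono (fun k => (Nat.le_succ k).trans (hnge k)) tendsto_id)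
  -- the limit is stationary at Es (exact stationarity along the sequence)
  have hstat : IsStationaryFor μ Es (ν : Measure 𝕊) := by
    refine isStationaryFor_of_tendsto hc hlimE' hlimν' fun f hf C hC => ?_
    have hzero : ∀ k, ∫ v, circleMarkov μ ((E ∘ ψ) k) f v ∂((νs ∘ ψ) k : Measure 𝕊) - ∫ v, f v ∂((νs ∘ ψ) k : Measure 𝕊) = 0 := by
      intro k
      rw [sub_eq_zero]
      exact (hνs (ψ k)).integral_eq hf.measurable hC
    simp_rw [hzero]
    exact tendsto_const_nhds
  have hKL := hstat.integral_circlePsi_eq_andersonLyapunov hc hnt hEs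
  have hKLj : ∀ k, ∫ v, circlePsi μ (E (ψ k)) v ∂((νs ∘ ψ) k : Measure 𝕊) = andersonLyapunov μ (E (ψ k)) := fun k =>
    (hνs (ψ k)).integral_circlePsi_eq_andersonLyapunov hc hnt (hE (ψ k))
  have hconv := tendsto_integral_circlePsi hc (fun k => hE (ψ k)) hEs hlimE' hlimν'
  -- L(E_k) + ε < L_{n_k}(E_k) ≤ L_{M+1}(E_k) + (M+1) log Γ / n_k
  set lg := Real.log Γ[μ] with hlg
  have hup : ∀ (M : ℕ) (k : ℕ), ∫ v, circlePsi μ (E (ψ k)) v ∂((νs ∘ ψ) k : Measure 𝕊) + ε ≤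
      andersonLogNormAvg μ (E (ψ k)) (M + 1) + (M + 1 : ℕ) * lg / (n (ψ k)) ∨ n (ψ k) < M + 1 := by
    intro M k
    by_cases hMn : M + 1 ≤ n (ψ k)
    · left
      rw [hKLj k]
      have h1 := hlt (ψ k)
      have h2 := andersonLogNormAvg_le_add_div hc (hE (ψ k)) (Nat.succ_pos M) hMn
      linarith
    · right; omega
  have hle : ∀ M : ℕ, ∫ v, circlePsi μ Es v ∂(ν : Measure 𝕊) + ε ≤ andersonLogNormAvg μ Es (M + 1) := by
    intro M
    have hcont : Tendsto (fun k => andersonLogNormAvg μ (E (ψ k)) (M + 1) + (M + 1 : ℕ) * lg / (n (ψ k))) atTop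
        (𝓝 (andersonLogNormAvg μ Es (M + 1) + 0)) :=
      (((continuous_andersonLogNormAvg_of_isCompact hc (M + 1)).tendsto Es).comp hlimE').add
        (tendsto_const_nhds.div_atTop hn_atTop)
    rw [add_zero] at hcont
    refine le_of_tendsto_of_tendsto (hconv.add_const ε) hcont ?_
    have hev : ∀ᶠ k in atTop, M + 1 ≤ n (ψ k) := by
      have := tendsto_atTop.mp (tendsto_atTop_mono (fun k => (Nat.le_succ k).trans (hnge k)) tendsto_id) (M + 1)
      exact this
    filter_upwards [hev] with k hk
    rcases hup M k with h | h
    · exact h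
    · exact absurd hk (not_le.mpr h)
  have : andersonLyapunov μ Es + ε ≤ andersonLyapunov μ Es :=
    calc andersonLyapunov μ Es + ε = ∫ v, circlePsi μ Es v ∂(ν : Measure 𝕊) + ε := by rw [hKL]
      _ ≤ ⨅ M : ℕ, andersonLogNormAvg μ Es (M + 1) := le_ciInf fun M => hle M
      _ = andersonLyapunov μ Es := rfl
  linarith

/-- **The one-scale uniform two-sided bound**: for every `ε > 0` there is a scale `N ≥ 1` with
`|𝔼 log ‖M_N^E u‖ - N L(E)| ≤ N ε` for all `E ∈ Σ̂` and all unit vectors `u`.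
[cite: BucajEtAl2019, Prop. 3.4 (uniform one-scale control) with Thm 2.6] -/
theorem exists_uniformScale {μ : Measure ℝ} [IsProbabilityMeasure μ] (hc : IsCompact μ.support)
    (hnt : μ.support.Nontrivial) :
    ∀ ε : ℝ, 0 < ε → ∃ N : ℕ, 1 ≤ N ∧
      ∀ E ∈ Icc (-andersonKappa μ) (andersonKappa μ), ∀ u : EuclideanSpace ℝ (Fin 2), ‖u‖ = 1 →
        |(∫ y, Real.log ‖Matrix.toEuclideanLin (andersonTransferProd E (padSeq y) N) u‖
            ∂(Measure.pi fun _ : Fin N => μ)) - N * andersonLyapunov μ E| ≤ N * ε := by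
  intro ε hε
  obtain ⟨N₁, hN₁⟩ := exists_uniform_lower_logMoment hc hnt hε
  obtain ⟨N₂, hN₂⟩ := exists_uniform_upper_logNormAvg hc hnt hε
  set N : ℕ := max (max N₁ N₂) 1 with hN
  refine ⟨N, le_max_right _ _, fun E hE u hu => ?_⟩
  have hN1 : N₁ ≤ N := (le_max_left _ _).trans (le_max_left _ _)
  have hN2 : N₂ ≤ N := (le_max_right _ _).trans (le_max_left _ _)
  have hNpos : 1 ≤ N := le_max_right _ _
  set w : 𝕊 := ⟨u, mem_sphere_zero_iff_norm.mpr hu⟩ with hw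
  have hlow := hN₁ N hN1 E hE w
  have hupper : ∫ y, Real.log ‖Matrix.toEuclideanLin (andersonTransferProd E (padSeq y) N) u‖ ∂(Measure.pi fun _ : Fin N => μ) ≤
      N * (andersonLyapunov μ E + ε) := by
    have h1 := integral_log_norm_apply_le_integral_log_norm hc hE N w
    have h2 := hN₂ N hN2 E hE
    have hNr : (0 : ℝ) < N := by exact_mod_cast hNpos
    have h3 : ∫ x, Real.log ‖andersonTransferProd E (padSeq x) N‖ ∂(Measure.pi fun _ : Fin N => μ) = N * andersonLogNormAvg μ E N := by
      unfold andersonLogNormAvg; field_simp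
    calc ∫ y, Real.log ‖Matrix.toEuclideanLin (andersonTransferProd E (padSeq y) N) u‖ ∂(Measure.pi fun _ : Fin N => μ)
        ≤ ∫ x, Real.log ‖andersonTransferProd E (padSeq x) N‖ ∂(Measure.pi fun _ : Fin N => μ) := h1
      _ = N * andersonLogNormAvg μ E N := h3
      _ ≤ N * (andersonLyapunov μ E + ε) := by gcongr
  rw [abs_le]
  constructor <;> nlinarith

/-- **Bucaj–Damanik–Fillman–Gerbuz–VandenBoom–Wang–Zhang, Prop. 3.6 (vectorwise uniform large
deviations), discharged.** The constants are uniform in the unit vector, in `n ≥ 1` and in the energy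
`E ∈ Σ̂ = [-κ, κ]`. The proof replaces the source's appeal to Bougerol–Lacroix (Prop. 2.10 there) by the
non-atomicity of stationary measures (strong irreducibility, Thm 2.3 there) and Fürstenberg's formula,
obtains the one-scale uniform bounds by compactness (Props. 3.2, 3.4 and Thm 2.6 there), and runs the
block-independence argument of the source in moment (Chernoff) form. [cite: BucajEtAl2019, Prop. 3.6] -/
theorem BucajEtAl2019_vectorLDT_holds : BucajEtAl2019_vectorLDT := by
  intro μ _ hc hnt ε hε
  exact vectorLDT_of_uniformScale μ hc (exists_uniformScale hc hnt) ε hε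

end Literature.Probability.RandomMatrixProducts

end

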